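import Literature.ComputerArithmetic.Rump2009.FastAccSum

/-!
# Rump 2009 §5: Algorithm 5.1 `FastPrecSum` (result "as if" computed in `K`-fold precision) and
# Proposition 5.2 (the faithful part), with the printed `ExactFlag` branch refuted

HONEST FRAMING (ENGINES group, unit `eng-quad-4`, kernels lane of the `certquad` engine — shared
numerical engines serving client cells; rigour lives in the verifiers; every published number
belongs to a client cell's ledger, not to the engines group): this file continues
`Rump2009.FastAccSum` (Algorithms 3.5, 4.2, 4.6, Theorem 4.11) with §5 of the same paper, at FORMAT
LEVEL — over the tree's binary floating-point numbers `JeannerodRump2018.IsFloat p emin` (precision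
`p`, gradual underflow from `emin`, NO overflow) and ANY round-to-nearest map
`JeannerodRump2018.IsRoundNearest p emin fl` (no tie rule fixed). Typed: Algorithm 5.1
`res = FastPrecSum(p, K)` literally (preamble, row-by-row extraction with `e = fl(e + p̃ᵢ)`, the
`ExactFlag` branch `res = e`, the last loop with its three result formulas), and PROVED:
(i) "we may go through this scheme in any order without changing the result" — the printed
row-by-row double loop computes the very same floating-point numbers as `K − 1` successive passes
of `ExtractVectorNew` (`rowExtract_eq_extractChain`, for every map `fl`); (ii) PROPOSITION 5.2, the
faithful part: for `pᵢ ∈ F`, `n ≥ 2`, `(2n²+4n+6)eps ≤ 1`, `eps ≤ 1/128`, if the `ExactFlag` is not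
set and the stopping criterion `|t^(m)| ≥ Φ^(m)` is satisfied for some `m ≤ K − 1`, then `res` is a
faithful rounding of `s = Σ pᵢ` (`isFaithfulRounding_fastPrecSum`) — with ONE additional hypothesis
of this formalisation in the case `m < K − 2` (i.e. only for `K ≥ 4`): `128n ≤ eps⁻¹` (note (b));
(iii) the `ExactFlag` branch as printed is NOT faithful (`fastPrecSum_exactFlag_counterexample`,
note (a)). NOT typed: the error estimate (5.3) for the exceptional case (no level satisfies the
criterion), the flop count `3Kn + O(K)`, the timings of §5, and `n ≤ 1`.

Source read at the page: [Rump2009] S. M. Rump, *Ultimately fast accurate summation*, SIAM J. Sci.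
Comput. 31(5) (2009) 3466–3502, doi:10.1137/080738490 (journal pagination): p. 3492 (§5, the
`n × m` array "in any order"), p. 3493 ((5.1)–(5.2), Algorithm 5.1 first half: `T^(0)`, the loop
computing `σ₀^(m)`, `Φ^(m)`, `T^(m)` and the `ExactFlag`, the extraction `for i … for m …
e = fl(e + p̃ᵢ)`), p. 3494 (Algorithm 5.1 second half: `if ExactFlag then res = e`, the last loop
with `τ₂ = fl((t − t^(m)) + τ^(m))`, `τ₃, τ₄`, the three `res =` lines; Proposition 5.2 and the
start of its proof, (5.3)–(5.4)), p. 3495 ((5.5)–(5.13)), p. 3496 ((5.14)–(5.18)), p. 3497 (the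
final estimate `|res| − 2eps⁻¹|δ| > …`), p. 3498 (end of §5).

DICTIONARY (source ↦ here; everything of `FastAccSum`'s dictionary continues: `eps ↦ unitRoundoff p`,
`eta ↦ 2^emin`, `eps⁻¹eta ↦ 2^(emin+p)`, `σ₀ = fl(fl(2T)/fl(1−(3n+1)eps)) ↦ sigmaZero fl p n T`,
`Φ ↦ phiBound fl p n σ₀`, `T^(m) ↦ tBound fl p n σ₀^(m)` (with Algorithm 3.5 `ufpFl` for `ufp`),
`ExtractVectorNew ↦ extractVectorNew`, `FastTwoSum ↦ fast2Sum`, `fl(Σ ·) ↦ flSum fl` / `flAcc fl e`,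
the loop invariant (4.23)/(4.33) ↦ `LoopInv`, Lemmas 4.9 / 4.10 ↦ `loop_continue` / `loop_exit_main`).
* Algorithm 5.1, first loop (`for m = 1 : K−1 … if 4T^(m) ≤ eps⁻¹eta then K = m+1; ExactFlag = true`)
  ↦ `precParams fl p emin n (K−1) T^(0) : List ℚ × Bool` = (`[σ₀^(1), …, σ₀^(K−1)]`, flag), the
  assignment `K = m + 1` read as ending the loop after level `m`; `T^(0)` ↦ `tInit fl p xs`.
* The extraction: one summand through all levels (`σ = fl(σ̃^(m) + p̃ᵢ); q = fl(σ − σ̃^(m));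
  p̃ᵢ = fl(p̃ᵢ − q); σ̃^(m) = σ`) ↦ `rowPass fl levels x` over the level states `(σ̃^(m), σ₀^(m))`;
  the double loop with `e = fl(e + p̃ᵢ)` ↦ `rowExtract fl levels e xs`; the same array column by
  column ↦ `extractChain fl levels xs` (successive `extractVectorNew`); (i) ↦ `rowExtract_eq_extractChain`.
* The last loop ↦ `finalLoop fl p n e t levels` with the fired result `firedResult fl e t^(m) τ₂ rest`
  (`m = K−1`: `fl(t^(m) + fl(τ₂ + e))`; `m = K−2`: `fl(t^(m) + fl(τ₃ + fl(τ₄ + e)))`; `m < K−2`: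
  `fl(t^(m) + fl(τ₃ + fl(τ₄ + τ^(m+2))))`); "the condition `|t^(m)| ≥ Φ^(m)` is satisfied for some
  `m`" ↦ `criterionMet` / `criterionMetRun … = true`; `res = FastPrecSum(p, K)` ↦
  `fastPrecSum fl p emin K xs`; the flag ↦ `exactFlag fl p emin K xs`.
* `τ₂ = fl((t − t^(m)) + τ^(m))`, `τ₄ = fl((τ₂ − τ₃) + τ^(m+1))` ARE the `FastTwoSum` corrections
  (the inner subtraction is exact under Lemma 3.4's hypothesis) ↦ `printed_correction_eq`.
* Proof of Proposition 5.2: (5.11) ↦ `sigmaZero_le_of_tBound_le`; the common part (5.5)–(5.10) with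
  the final estimate, for an abstract last summand `T ∈ F`, `Σ pᵢ^(m+1) = T + Δ` ↦ `window_faithful`;
  case `m = K−2` ((5.12)–(5.13)) ↦ `fired_caseA_faithful`; case `m < K−2` ((5.14)–(5.15)) ↦
  `fired_caseB_faithful`; the constant bookkeeping ↦ `poly52a`, `poly52aU`, `poly52b`, `poly52bU`;
  "denote by `m` the first index for which `|t^(m)| ≥ Φ^(m)`" ↦ the induction `finalLoop_faithful`
  (levels before `m`: `loop_continue`; `m = K−1`: "the results of FastAccSum and FastPrecSum are the
  same", `loop_exit_main`).

NOTES (findings while typing).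
(a) REFUTED AS PRINTED: `if ExactFlag then res = e`. The text says "If the ExactFlag is set, then by
    Lemma 4.10 the floating-point sum of the extracted vector is equal to the true sum"; but Lemma
    4.10 concerns `t^(m−1) + τ^(m) + Σ pᵢ^(m)` (FastAccSum returns `fl(τ₁ + fl(τ₂ + fl(Σ pᵢ^(m))))`
    there), whereas `e = fl(Σ p̃ᵢ)` drops the exact high-order parts `τ^(ν) = σ̃^(ν) − σ₀^(ν)`. For
    `p = (X, X)`, `X = eps⁻¹eta`, any `K ≥ 2` and any rounding to nearest (`p ≥ 7`, `emin + 2p ≤ 0`)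
    the flag is raised at `m = 1`, `p̃ᵢ = 0`, `res = e = 0 ≠ 2X = s` with `X ∈ F` strictly between:
    `fastPrecSum_exactFlag_counterexample`. Proposition 5.2 is therefore typed under `exactFlag = false`
    (the proof's "we may assume that the ExactFlag was not set"). The evident repair (`res =
    fl(Σ_ν τ^(ν) + e)`, cf. (5.2)) is not in the source and is not typed here (this file types
    only what is printed).
(b) In the final estimate (p. 3497) the printed chain bounds `eps⁻¹|δ|` by `… + |Δ|`, while
    `δ = δ₃ + δ₄ + Δ` ((5.10)) contributes `eps⁻¹|Δ|`. With the correct term the case `m = K−2`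
    ((5.13): `|Δ| ≤ ½n(n−1)eps²σ₀^(m+1)`) still closes under the paper's hypotheses (typed so); in the
    case `m < K−2` ((5.15): `|Δ| ≤ n·eps·σ₀^(m+2)`, so `eps⁻¹|Δ| ≲ 16n³ϕ²eps²·ufp(σ₀^(m))`) the margin
    `(n−1) − (38n²+33n+7)eps + O(eps²)` is negative for small `n` at `eps = 1/128` (e.g. `n = 2`),
    and we assume in addition `128n·eps ≤ 1` (automatic for `n ≥ 62`, and for every admissible
    `n` once `eps ≤ 2^-13`, in particular in binary32/binary64: `2n² ≤ eps⁻¹` gives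
    `128n ≤ 2^(7+(p−1)/2) ≤ 2^p`). Whether Proposition 5.2 holds as printed for `K ≥ 4`, `n ≤ 61`,
    `2^-12 ≤ eps ≤ 2^-7` is left open here.
(c) `Φ^(m)`, `T^(m)` are functions of `σ₀^(m)` (`phiBound`, `tBound`) and are recomputed where the
    algorithm stores them; `u = ufp(σ₀^(m))` by Algorithm 3.5 is `ufpFl` inside `tBound`/`phiBound`
    exactly as in `FastAccSum` (Lemma 3.7).
(d) As in `FastAccSum`: `n ≥ 2`, hypotheses `2 * n ^ 2 + 4 * n + 6 ≤ 2 ^ p`, `7 ≤ p`,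
    `emin + 2 * p ≤ 0`; (5.3) and the "as if in K-fold precision" remark are not typed.
-/
namespace Literature.ComputerArithmetic.Rump2009

open Literature.ComputerArithmetic.JeannerodRump2018
open Literature.ComputerArithmetic.BoldoJeannerodMelquiondMuller2023
open Literature.ComputerArithmetic.RumpOgitaOishi2008
open Literature.ComputerArithmetic.JoldesMullerPopescu2017 (isFloat_two_zpow two_zpow_emin_le_abs)
open Literature.ComputerArithmetic.RumpOgitaOishi2009 (isFloat_flSum)
open Literature.ComputerArithmetic.LangeRump2018 (abs_list_sum_le)

variable {p : ℕ} {emin : ℤ} {fl : ℚ → ℚ}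

/-! ### Algorithm 5.1: the preamble (the constants `σ₀^(m)`, `Φ^(m)`, `T^(m)` and the `ExactFlag`) -/

/-- The first loop of Algorithm 5.1: from `T^(0)`, for `m = 1, 2, …` (at most `k = K − 1` levels)
`σ₀^(m) = fl(fl(2T^(m−1))/fl(1 − (3n+1)eps))` (`sigmaZero`), `T^(m)` (`tBound`, with Algorithm 3.5 for
`ufp(σ₀^(m))`), and `if 4T^(m) ≤ eps⁻¹eta then K = m + 1; ExactFlag = true` — read as terminating the
loop after level `m`. Returns the list `[σ₀^(1), …, σ₀^(K−1)]` and the flag (`Φ^(m) = phiBound σ₀^(m)` and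
`T^(m) = tBound σ₀^(m)` are functions of `σ₀^(m)` and are recomputed where used).
[cite: Rump2009, Algorithm 5.1 (first `for` loop)] -/
def precParams (fl : ℚ → ℚ) (p : ℕ) (emin : ℤ) (n : ℕ) : ℕ → ℚ → List ℚ × Bool
  | 0, _ => ([], false)
  | k + 1, T =>
      if 4 * tBound fl p n (sigmaZero fl p n T) ≤ (2 : ℚ) ^ (emin + p) then ([sigmaZero fl p n T], true)
      else (sigmaZero fl p n T :: (precParams fl p emin n k (tBound fl p n (sigmaZero fl p n T))).1,
        (precParams fl p emin n k (tBound fl p n (sigmaZero fl p n T))).2)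

/-- Unfolding one level of the preamble. [cite: Rump2009, Algorithm 5.1 (first `for` loop)] -/
theorem precParams_succ (fl : ℚ → ℚ) (p : ℕ) (emin : ℤ) (n k : ℕ) (T : ℚ) :
    precParams fl p emin n (k + 1) T =
      if 4 * tBound fl p n (sigmaZero fl p n T) ≤ (2 : ℚ) ^ (emin + p) then ([sigmaZero fl p n T], true)
      else (sigmaZero fl p n T :: (precParams fl p emin n k (tBound fl p n (sigmaZero fl p n T))).1,
        (precParams fl p emin n k (tBound fl p n (sigmaZero fl p n T))).2) := rfl

/-- No level, no flag. [cite: Rump2009, Algorithm 5.1 (first `for` loop, `K = 1`)] -/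
@[simp] theorem precParams_zero (fl : ℚ → ℚ) (p : ℕ) (emin : ℤ) (n : ℕ) (T : ℚ) :
    precParams fl p emin n 0 T = ([], false) := rfl

/-! ### Algorithm 5.1: the extraction, row by row (as printed) and column by column -/

/-- The inner `for m = 1 : K − 1` loop of Algorithm 5.1 for ONE summand `p̃ᵢ = x`, run through the
levels with state `(σ̃^(m), σ₀^(m))_m` (the constants `σ₀^(m)` are carried along read-only):
`σ = fl(σ̃^(m) + p̃ᵢ); q = fl(σ − σ̃^(m)); p̃ᵢ = fl(p̃ᵢ − q); σ̃^(m) = σ`, i.e.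
`[σ̃^(m), p̃ᵢ] ← FastTwoSum(σ̃^(m), p̃ᵢ)`. Returns the updated levels and the final `p̃ᵢ`.
[cite: Rump2009, Algorithm 5.1 (inner loop of the extraction)] -/
def rowPass (fl : ℚ → ℚ) : List (ℚ × ℚ) → ℚ → List (ℚ × ℚ) × ℚ
  | [], x => ([], x)
  | (σt, σ0) :: rest, x =>
      ((fl (σt + x), σ0) :: (rowPass fl rest (fast2Sum fl σt x).2).1,
        (rowPass fl rest (fast2Sum fl σt x).2).2)

/-- The double loop `for i = 1 : n, (for m = 1 : K − 1, …), e = fl(e + p̃ᵢ)` of Algorithm 5.1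
(row by row through the `n × (K−1)` scheme), with state `((σ̃^(m), σ₀^(m))_m, e)`.
[cite: Rump2009, Algorithm 5.1 (the extraction and `e = fl(e + p̃ᵢ)`)] -/
def rowExtract (fl : ℚ → ℚ) : List (ℚ × ℚ) → ℚ → List ℚ → List (ℚ × ℚ) × ℚ
  | lv, e, [] => (lv, e)
  | lv, e, x :: xs => rowExtract fl (rowPass fl lv x).1 (fl (e + (rowPass fl lv x).2)) xs

/-- The same scheme column by column, as in `FastAccSum`: `[σ̃^(1), p^(1)] = ExtractVectorNew(σ̃^(1), p)`,
`[σ̃^(2), p^(2)] = ExtractVectorNew(σ̃^(2), p^(1))`, …; returns the levels and the last vector `p^(K−1)`.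
[cite: Rump2009, §5 (p. 3492: "an array of n × m numbers … column by column")] -/
def extractChain (fl : ℚ → ℚ) : List (ℚ × ℚ) → List ℚ → List (ℚ × ℚ) × List ℚ
  | [], xs => ([], xs)
  | (σt, σ0) :: rest, xs =>
      (((extractVectorNew fl σt xs).1, σ0) :: (extractChain fl rest (extractVectorNew fl σt xs).2).1,
        (extractChain fl rest (extractVectorNew fl σt xs).2).2)

/-- No level: the summand passes unchanged. [cite: Rump2009, Algorithm 5.1 (inner `for m` loop)] -/
@[simp] theorem rowPass_nil (fl : ℚ → ℚ) (x : ℚ) : rowPass fl [] x = ([], x) := rfl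

/-- One level of the inner loop: `[σ̃^(m), p̃ᵢ] ← FastTwoSum(σ̃^(m), p̃ᵢ)`. [cite: Rump2009, Algorithm 5.1 (inner `for m` loop)] -/
theorem rowPass_cons (fl : ℚ → ℚ) (σt σ0 : ℚ) (rest : List (ℚ × ℚ)) (x : ℚ) :
    rowPass fl ((σt, σ0) :: rest) x =
      ((fl (σt + x), σ0) :: (rowPass fl rest (fast2Sum fl σt x).2).1,
        (rowPass fl rest (fast2Sum fl σt x).2).2) := rfl

/-- No summand left: the levels and `e` are returned. [cite: Rump2009, Algorithm 5.1 (`for i` loop)] -/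
@[simp] theorem rowExtract_nil (fl : ℚ → ℚ) (lv : List (ℚ × ℚ)) (e : ℚ) :
    rowExtract fl lv e [] = (lv, e) := rfl

/-- One summand: a row pass, then `e = fl(e + p̃ᵢ)`. [cite: Rump2009, Algorithm 5.1 (`for i` loop)] -/
theorem rowExtract_cons (fl : ℚ → ℚ) (lv : List (ℚ × ℚ)) (e x : ℚ) (xs : List ℚ) :
    rowExtract fl lv e (x :: xs) = rowExtract fl (rowPass fl lv x).1 (fl (e + (rowPass fl lv x).2)) xs :=
  rfl

/-- No level: the vector is unchanged. [cite: Rump2009, §5 (p. 3492, the `n × m` array)] -/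
@[simp] theorem extractChain_nil (fl : ℚ → ℚ) (xs : List ℚ) : extractChain fl [] xs = ([], xs) := rfl

/-- One level column by column is one pass of `ExtractVectorNew`. [cite: Rump2009, §5 (p. 3492, the `n × m` array)] -/
theorem extractChain_cons (fl : ℚ → ℚ) (σt σ0 : ℚ) (rest : List (ℚ × ℚ)) (xs : List ℚ) :
    extractChain fl ((σt, σ0) :: rest) xs =
      (((extractVectorNew fl σt xs).1, σ0) :: (extractChain fl rest (extractVectorNew fl σt xs).2).1,
        (extractChain fl rest (extractVectorNew fl σt xs).2).2) := rfl

/-- Column by column on the empty vector: nothing changes. [cite: Rump2009, §5 (p. 3492)] -/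
theorem extractChain_nil_right (fl : ℚ → ℚ) : ∀ lv : List (ℚ × ℚ), extractChain fl lv [] = (lv, [])
  | [] => rfl
  | (σt, σ0) :: rest => by
      rw [extractChain_cons, extractVectorNew_nil, extractChain_nil_right fl rest]

/-- Peeling the first summand off the column-by-column scheme is one row pass.
[cite: Rump2009, §5 (p. 3492: "we may go through this scheme in any order")] -/
theorem extractChain_cons_right (fl : ℚ → ℚ) : ∀ (lv : List (ℚ × ℚ)) (x : ℚ) (xs : List ℚ),
    extractChain fl lv (x :: xs) =
      ((extractChain fl (rowPass fl lv x).1 xs).1,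
        (rowPass fl lv x).2 :: (extractChain fl (rowPass fl lv x).1 xs).2)
  | [], x, xs => rfl
  | (σt, σ0) :: rest, x, xs => by
      rw [extractChain_cons, extractVectorNew_cons, rowPass_cons, extractChain_cons,
        extractChain_cons_right fl rest _ _]

/-- **Row by row = column by column** ("all transformations are error-free … we may go through this
scheme in any order without changing the result"; here: literally the same floating-point numbers are
computed, for ANY map `fl`): the printed double loop returns the levels `σ̃^(m)` of the successive
`ExtractVectorNew` passes and `e = fl(Σ p̃ᵢ)` accumulated from `e` over the last vector.
[cite: Rump2009, §5 (p. 3492) and Algorithm 5.1] -/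
theorem rowExtract_eq_extractChain (fl : ℚ → ℚ) : ∀ (xs : List ℚ) (lv : List (ℚ × ℚ)) (e : ℚ),
    rowExtract fl lv e xs = ((extractChain fl lv xs).1, flAcc fl e (extractChain fl lv xs).2)
  | [], lv, e => by rw [rowExtract_nil, extractChain_nil_right, flAcc_nil]
  | x :: xs, lv, e => by
      rw [rowExtract_cons, rowExtract_eq_extractChain fl xs, extractChain_cons_right, flAcc_cons]

/-! ### Algorithm 5.1: the final loop and the result -/

/-- The result of Algorithm 5.1 once `|t^(m)| ≥ Φ^(m)` holds at level `m` with `t^(m) = t1` and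
`τ₂ = fl(fl(t − t^(m)) + τ^(m))`, given the remaining levels `(σ̃^(ν), σ₀^(ν))`, `ν = m+1, …, K−1`:
`m = K−1`: `res = fl(t^(m) + fl(τ₂ + e))`; else `τ^(m+1) = fl(σ̃^(m+1) − σ₀^(m+1))`,
`τ₃ = fl(τ₂ + τ^(m+1))`, `τ₄ = fl(fl(τ₂ − τ₃) + τ^(m+1))`; `m = K−2`: `res = fl(t^(m) + fl(τ₃ + fl(τ₄ + e)))`;
`m < K−2`: `res = fl(t^(m) + fl(τ₃ + fl(τ₄ + fl(σ̃^(m+2) − σ₀^(m+2)))))`.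
[cite: Rump2009, Algorithm 5.1 (the branch `if |t^(m)| ≥ Φ^(m)`)] -/
def firedResult (fl : ℚ → ℚ) (e t1 τ2 : ℚ) : List (ℚ × ℚ) → ℚ
  | [] => fl (t1 + fl (τ2 + e))
  | [(σt1, σ01)] =>
      fl (t1 + fl (fl (τ2 + fl (σt1 - σ01)) +
        fl (fl (fl (τ2 - fl (τ2 + fl (σt1 - σ01))) + fl (σt1 - σ01)) + e)))
  | (σt1, σ01) :: (σt2, σ02) :: _ =>
      fl (t1 + fl (fl (τ2 + fl (σt1 - σ01)) +
        fl (fl (fl (τ2 - fl (τ2 + fl (σt1 - σ01))) + fl (σt1 - σ01)) + fl (σt2 - σ02))))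

/-- The last loop of Algorithm 5.1 from state `t` over the remaining levels: `τ^(m) = fl(σ̃^(m) − σ₀^(m))`,
`t^(m) = fl(t + τ^(m))`; if `|t^(m)| ≥ Φ^(m)` the result is `firedResult`, else continue with `t = t^(m)`;
after the last level `res = fl(t + e)` ("may be no faithful rounding").
[cite: Rump2009, Algorithm 5.1 (last `for` loop)] -/
def finalLoop (fl : ℚ → ℚ) (p n : ℕ) (e : ℚ) : ℚ → List (ℚ × ℚ) → ℚ
  | t, [] => fl (t + e)
  | t, (σt, σ0) :: rest =>
      if phiBound fl p n σ0 ≤ |fl (t + fl (σt - σ0))| then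
        firedResult fl e (fl (t + fl (σt - σ0))) (fl (fl (t - fl (t + fl (σt - σ0))) + fl (σt - σ0))) rest
      else finalLoop fl p n e (fl (t + fl (σt - σ0))) rest

/-- Whether the stopping criterion `|t^(m)| ≥ Φ^(m)` is met at some level of the last loop (the
exceptional case of Proposition 5.2 is its negation). [cite: Rump2009, Algorithm 5.1 and Proposition 5.2] -/
def criterionMet (fl : ℚ → ℚ) (p n : ℕ) : ℚ → List (ℚ × ℚ) → Bool
  | _, [] => false
  | t, (σt, σ0) :: rest =>
      if phiBound fl p n σ0 ≤ |fl (t + fl (σt - σ0))| then true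
      else criterionMet fl p n (fl (t + fl (σt - σ0))) rest

/-- After the last level: `res = fl(t^(m) + e)`. [cite: Rump2009, Algorithm 5.1 (last line)] -/
theorem finalLoop_nil (fl : ℚ → ℚ) (p n : ℕ) (e t : ℚ) : finalLoop fl p n e t [] = fl (t + e) := rfl

/-- One level of the last loop. [cite: Rump2009, Algorithm 5.1 (last `for` loop)] -/
theorem finalLoop_cons (fl : ℚ → ℚ) (p n : ℕ) (e t σt σ0 : ℚ) (rest : List (ℚ × ℚ)) :
    finalLoop fl p n e t ((σt, σ0) :: rest) =
      if phiBound fl p n σ0 ≤ |fl (t + fl (σt - σ0))| then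
        firedResult fl e (fl (t + fl (σt - σ0))) (fl (fl (t - fl (t + fl (σt - σ0))) + fl (σt - σ0))) rest
      else finalLoop fl p n e (fl (t + fl (σt - σ0))) rest := rfl

/-- No level left: the criterion was never met. [cite: Rump2009, Algorithm 5.1 and Proposition 5.2] -/
@[simp] theorem criterionMet_nil (fl : ℚ → ℚ) (p n : ℕ) (t : ℚ) : criterionMet fl p n t [] = false := rfl

/-- One level of the last loop, for the criterion. [cite: Rump2009, Algorithm 5.1 (last `for` loop)] -/
theorem criterionMet_cons (fl : ℚ → ℚ) (p n : ℕ) (t σt σ0 : ℚ) (rest : List (ℚ × ℚ)) :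
    criterionMet fl p n t ((σt, σ0) :: rest) =
      if phiBound fl p n σ0 ≤ |fl (t + fl (σt - σ0))| then true
      else criterionMet fl p n (fl (t + fl (σt - σ0))) rest := rfl

/-- `T^(0) = fl(fl(Σ|pᵢ|)/(1 − n·eps))` of Algorithms 4.6 / 5.1. [cite: Rump2009, Algorithm 5.1] -/
def tInit (fl : ℚ → ℚ) (p : ℕ) (xs : List ℚ) : ℚ :=
  fl (flSum fl (xs.map abs) / fl (1 - fl ((xs.length : ℚ) * unitRoundoff p)))

/-- **Algorithm 5.1 `res = FastPrecSum(p, K)`**: the preamble (`precParams`), the row-by-row extraction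
with `e = fl(Σ p̃ᵢ)` (`rowExtract`, levels initialised `σ̃^(m) = σ₀^(m)`), then `res = e` if the
`ExactFlag` is set, else the last loop from `t = 0` (`finalLoop`).
[cite: Rump2009, Algorithm 5.1 `FastPrecSum`] -/
def fastPrecSum (fl : ℚ → ℚ) (p : ℕ) (emin : ℤ) (K : ℕ) (xs : List ℚ) : ℚ :=
  if (precParams fl p emin xs.length (K - 1) (tInit fl p xs)).2 then
    (rowExtract fl (((precParams fl p emin xs.length (K - 1) (tInit fl p xs)).1).map fun s => (s, s))
      0 xs).2
  else
    finalLoop fl p xs.length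
      (rowExtract fl (((precParams fl p emin xs.length (K - 1) (tInit fl p xs)).1).map fun s => (s, s))
        0 xs).2
      0
      (rowExtract fl (((precParams fl p emin xs.length (K - 1) (tInit fl p xs)).1).map fun s => (s, s))
        0 xs).1

/-- The `ExactFlag` of a run of Algorithm 5.1. [cite: Rump2009, Algorithm 5.1] -/
def exactFlag (fl : ℚ → ℚ) (p : ℕ) (emin : ℤ) (K : ℕ) (xs : List ℚ) : Bool :=
  (precParams fl p emin xs.length (K - 1) (tInit fl p xs)).2

/-- Whether `|t^(m)| ≥ Φ^(m)` is satisfied for some `1 ≤ m ≤ K − 1` in a run of Algorithm 5.1.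
[cite: Rump2009, Proposition 5.2 ("except when the condition … is never satisfied")] -/
def criterionMetRun (fl : ℚ → ℚ) (p : ℕ) (emin : ℤ) (K : ℕ) (xs : List ℚ) : Bool :=
  criterionMet fl p xs.length 0
    (rowExtract fl (((precParams fl p emin xs.length (K - 1) (tInit fl p xs)).1).map fun s => (s, s))
      0 xs).1

/-! ### Structural facts: `e = fl(Σ p̃ᵢ)`, the printed `τ₂`, `τ₄` are the `FastTwoSum` corrections -/

/-- `e = 0; e = fl(e + p̃ᵢ) (i = 1..n)` is `fl(Σ p̃ᵢ)` by recursive summation when `p̃₁ ∈ F`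
(`fl(0 + p̃₁) = p̃₁`). [cite: Rump2009, Algorithm 5.1 (`e = fl(e + p̃ᵢ)`) and eq. (5.4)] -/
theorem flAcc_zero_eq_flSum (hfl : IsRoundNearest p emin fl) {xs : List ℚ}
    (hxs : ∀ x ∈ xs, IsFloat p emin x) : flAcc fl 0 xs = flSum fl xs := by
  cases xs with
  | nil => rfl
  | cons x rest => rw [flAcc_cons, zero_add, fl_eq_self hfl (hxs x (by simp)), flSum_cons]

/-- The printed `τ₂ = fl((t − t^(m)) + τ^(m))` IS the `FastTwoSum(t, τ^(m))` correction (whose middle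
subtraction is exact under Lemma 3.4's hypothesis, so `t − t^(m) ∈ F`).
[cite: Rump2009, Algorithm 5.1 (comment `[t^(m), τ₂] = FastTwoSum(t, τ^(m))`) and Lemma 3.4] -/
theorem printed_correction_eq (hp : 1 ≤ p) (hfl : IsRoundNearest p emin fl) {t τ : ℚ}
    (ht : IsFloat p emin t) (hτ : IsFloat p emin τ)
    (hgrid : τ = 0 ∨ OnGrid (2 * unitRoundoff p * ufp τ) t) :
    fl (fl (t - fl (t + τ)) + τ) = (fast2Sum fl t τ).2 := by
  have h2 : (fast2Sum fl t τ).2 = fl (τ - fl (fl (t + τ) - t)) := rfl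
  rcases hgrid with h0 | hg
  · subst h0
    have ht0 : fl (t + 0) = t := by rw [add_zero, fl_eq_self hfl ht]
    rw [h2, ht0, sub_self, fl_zero hfl, add_zero, sub_zero]
  · obtain ⟨h1, -, -, -, -⟩ := fastTwoSum_eft hp hfl ht hτ hg
    have hF : IsFloat p emin (fl (t + τ) - t) := by rw [← h1]; exact (hfl _).1
    have hF' : IsFloat p emin (t - fl (t + τ)) := by
      have := hF.neg; rwa [neg_sub] at this
    rw [h2, h1, fl_eq_self hfl hF', show t - fl (t + τ) + τ = τ - (fl (t + τ) - t) by ring]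

/-! ### Proposition 5.2: constants -/

/-- Constant bookkeeping for Proposition 5.2, case `m = K − 2`: our sufficient condition for
`|res| − 2eps⁻¹|δ| > 0` in terms of `n` and `eps` (margin `(n−1) − (7n²+30n+9)eps + O(eps²) > 0`).
[cite: Rump2009, proof of Proposition 5.2 (case m = K−2, eqs. (5.12)–(5.13) and the final estimate)] -/
theorem poly52a {u n : ℚ} (hu0 : 0 < u) (hu : u ≤ 1 / 128) (hn : 2 ≤ n)
    (hN : (2 * n ^ 2 + 4 * n + 6) * u ≤ 1) :
    (3 + 8 * u + 20 * n * u + 4 * n * (n - 1) * u) * (1 - 5 * u) <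
      (1 - 5 * u - 7 * u ^ 2) * (1 - u) * (n + 2) * (1 - (3 * n + 2) * u) := by
  have hnn : 0 ≤ n := by linarith
  have key : u * (7 * n ^ 2 + 30 * n + 9) < n - 1 := by
    rcases le_or_gt n 6 with h6 | h6
    · have h0 : 0 ≤ 7 * n ^ 2 + 30 * n + 9 := by positivity
      have h1 : u * (7 * n ^ 2 + 30 * n + 9) ≤ (7 * n ^ 2 + 30 * n + 9) * (1 / 128) := by
        nlinarith [mul_nonneg h0 (sub_nonneg.2 hu)]
      nlinarith [mul_nonneg (sub_nonneg.2 hn) (sub_nonneg.2 h6)]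
    · have h1 : 7 * n ^ 2 + 30 * n + 9 < (n - 1) * (2 * n ^ 2 + 4 * n + 6) := by nlinarith
      have h2 : u * (7 * n ^ 2 + 30 * n + 9) < u * ((n - 1) * (2 * n ^ 2 + 4 * n + 6)) :=
        mul_lt_mul_of_pos_left h1 hu0
      have h4 : (n - 1) * ((2 * n ^ 2 + 4 * n + 6) * u) ≤ (n - 1) * 1 :=
        mul_le_mul_of_nonneg_left hN (by linarith)
      linarith
  have hu42 : u ^ 4 ≤ u ^ 2 := by
    have h1 : u ^ 2 ≤ 1 := by nlinarith
    calc u ^ 4 = u ^ 2 * u ^ 2 := by ring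
      _ ≤ u ^ 2 * 1 := mul_le_mul_of_nonneg_left h1 (sq_nonneg u)
      _ = u ^ 2 := mul_one _
  have t : u ^ 4 * (21 * n ^ 2 + 56 * n + 28) ≤ u ^ 2 * (38 * n ^ 2 + 126 * n + 60) := by
    have a : u ^ 4 * (21 * n ^ 2 + 56 * n + 28) ≤ u ^ 2 * (21 * n ^ 2 + 56 * n + 28) :=
      mul_le_mul_of_nonneg_right hu42 (by positivity)
    have b : u ^ 2 * (21 * n ^ 2 + 56 * n + 28) ≤ u ^ 2 * (38 * n ^ 2 + 126 * n + 60) :=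
      mul_le_mul_of_nonneg_left (by nlinarith) (sq_nonneg u)
    linarith
  have t3 : 0 ≤ u ^ 3 * (6 * n ^ 2 + 23 * n + 22) := by positivity
  nlinarith [key, t, t3]

/-- Constant bookkeeping for Proposition 5.2, `res ∉ U` in case `m = K − 2`.
[cite: Rump2009, proof of Proposition 5.2 (res ∉ U, cf. (4.41)–(4.42))] -/
theorem poly52aU {u n : ℚ} (hu0 : 0 < u) (hu : u ≤ 1 / 128) (hn : 2 ≤ n)
    (hN : (2 * n ^ 2 + 4 * n + 6) * u ≤ 1) :
    (2 * (1 - (3 * n + 2) * u) + (1 + 4 * u) + 4 * (1 + u) * n * u) * (1 - 5 * u) ≤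
      (1 - 2 * u - 4 * u ^ 2) * (1 - u) * (n + 2) * (1 - (3 * n + 2) * u) := by
  have hnn : 0 ≤ n := by linarith
  -- margin = (n−1) − u(3n²+9n−5) + u²(9n²+8n+8) + u³(6n²+40n+16) − u⁴(12n²+32n+16)
  have key : u * (3 * n ^ 2 + 9 * n - 5) ≤ n - 1 := by
    rcases le_or_gt n 3 with h3 | h3
    · have h0 : 3 * n ^ 2 + 9 * n - 5 ≤ 49 := by nlinarith
      have h1 : u * (3 * n ^ 2 + 9 * n - 5) ≤ u * 49 := mul_le_mul_of_nonneg_left h0 hu0.le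
      nlinarith
    · have h1 : 3 * n ^ 2 + 9 * n - 5 ≤ (n - 1) * (2 * n ^ 2 + 4 * n + 6) := by nlinarith
      have h2 : u * (3 * n ^ 2 + 9 * n - 5) ≤ u * ((n - 1) * (2 * n ^ 2 + 4 * n + 6)) :=
        mul_le_mul_of_nonneg_left h1 hu0.le
      have h4 : (n - 1) * ((2 * n ^ 2 + 4 * n + 6) * u) ≤ (n - 1) * 1 :=
        mul_le_mul_of_nonneg_left hN (by linarith)
      linarith
  have hu42 : u ^ 4 ≤ u ^ 2 / 16384 := by
    have h1 : u ^ 2 ≤ 1 / 16384 := by nlinarith [mul_le_mul hu hu hu0.le (by norm_num : (0:ℚ) ≤ 1 / 128)]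
    calc u ^ 4 = u ^ 2 * u ^ 2 := by ring
      _ ≤ u ^ 2 * (1 / 16384) := mul_le_mul_of_nonneg_left h1 (sq_nonneg u)
      _ = u ^ 2 / 16384 := by ring
  have t : u ^ 4 * (12 * n ^ 2 + 32 * n + 16) ≤ u ^ 2 * (9 * n ^ 2 + 8 * n + 8) := by
    have a : u ^ 4 * (12 * n ^ 2 + 32 * n + 16) ≤ u ^ 2 / 16384 * (12 * n ^ 2 + 32 * n + 16) :=
      mul_le_mul_of_nonneg_right hu42 (by positivity)
    have b : u ^ 2 / 16384 * (12 * n ^ 2 + 32 * n + 16) ≤ u ^ 2 * (9 * n ^ 2 + 8 * n + 8) := by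
      rw [show u ^ 2 / 16384 * (12 * n ^ 2 + 32 * n + 16) = u ^ 2 * ((12 * n ^ 2 + 32 * n + 16) / 16384)
        by ring]
      refine mul_le_mul_of_nonneg_left ?_ (sq_nonneg u)
      rw [div_le_iff₀ (by norm_num : (0:ℚ) < 16384)]
      nlinarith [sq_nonneg n]
    linarith
  have t3 : 0 ≤ u ^ 3 * (6 * n ^ 2 + 40 * n + 16) := by positivity
  nlinarith [key, t, t3]

/-- Constant bookkeeping for Proposition 5.2, case `m < K − 2`, under the ADDITIONAL hypothesis
`128n·eps ≤ 1` of this formalisation (see the file header, note (b)).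
[cite: Rump2009, proof of Proposition 5.2 (case m < K−2, eqs. (5.14)–(5.15) and the final estimate)] -/
theorem poly52b {u n : ℚ} (hu0 : 0 < u) (hn : 2 ≤ n) (h128 : 128 * n * u ≤ 1) :
    ((3 + 8 * u) * (1 - (3 * n + 2) * u) + (20 + 32 * n) * n * u) * (1 - 5 * u) <
      (1 - 5 * u - 7 * u ^ 2) * (1 - u) * (n + 2) * (1 - (3 * n + 2) * u) ^ 2 := by
  have hnn : 0 ≤ n := by linarith
  have hnu : n * u ≤ 1 / 128 := by linarith
  have hu : u ≤ 1 / 256 := by nlinarith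
  -- margin = (n−1) − u(38n²+33n+7) + u²(9n³+226n²+201n+78) − u³(54n³+168n²+249n+98)
  --          − u⁴(18n³+102n²+168n+72) + u⁵(63n³+210n²+196n+56)
  have key : u * (38 * n ^ 2 + 33 * n + 7) < n - 1 := by
    have h1 : 38 * n ^ 2 + 33 * n + 7 < 128 * n * (n - 1) := by nlinarith
    have h2 : u * (38 * n ^ 2 + 33 * n + 7) < u * (128 * n * (n - 1)) := mul_lt_mul_of_pos_left h1 hu0
    have h3 : u * (128 * n * (n - 1)) = (n - 1) * (128 * n * u) := by ring
    have h4 : (n - 1) * (128 * n * u) ≤ (n - 1) * 1 := mul_le_mul_of_nonneg_left h128 (by linarith)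
    linarith
  have b3 : u * (54 * n ^ 3 + 168 * n ^ 2 + 249 * n + 98) ≤
      (9 * n ^ 3 + 226 * n ^ 2 + 201 * n + 78) / 2 := by
    have e : u * (54 * n ^ 3 + 168 * n ^ 2 + 249 * n + 98) =
        (54 * n ^ 2 + 168 * n + 249) * (n * u) + 98 * u := by ring
    have h1 : (54 * n ^ 2 + 168 * n + 249) * (n * u) ≤ (54 * n ^ 2 + 168 * n + 249) * (1 / 128) :=
      mul_le_mul_of_nonneg_left hnu (by positivity)
    rw [e]; nlinarith [pow_nonneg hnn 3]
  have b4 : u ^ 2 * (18 * n ^ 3 + 102 * n ^ 2 + 168 * n + 72) ≤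
      (9 * n ^ 3 + 226 * n ^ 2 + 201 * n + 78) / 2 := by
    have e : u ^ 2 * (18 * n ^ 3 + 102 * n ^ 2 + 168 * n + 72) =
        u * ((18 * n ^ 2 + 102 * n + 168) * (n * u) + 72 * u) := by ring
    have h1 : (18 * n ^ 2 + 102 * n + 168) * (n * u) ≤ (18 * n ^ 2 + 102 * n + 168) * (1 / 128) :=
      mul_le_mul_of_nonneg_left hnu (by positivity)
    have h2 : u * ((18 * n ^ 2 + 102 * n + 168) * (n * u) + 72 * u) ≤
        1 / 256 * ((18 * n ^ 2 + 102 * n + 168) * (1 / 128) + 72 * (1 / 256)) := by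
      apply mul_le_mul hu (by linarith) (by positivity) (by norm_num)
    rw [e]; nlinarith [pow_nonneg hnn 3]
  have t : u ^ 3 * (54 * n ^ 3 + 168 * n ^ 2 + 249 * n + 98) +
      u ^ 4 * (18 * n ^ 3 + 102 * n ^ 2 + 168 * n + 72) ≤
      u ^ 2 * (9 * n ^ 3 + 226 * n ^ 2 + 201 * n + 78) := by
    have e : u ^ 3 * (54 * n ^ 3 + 168 * n ^ 2 + 249 * n + 98) +
        u ^ 4 * (18 * n ^ 3 + 102 * n ^ 2 + 168 * n + 72) =
        u ^ 2 * (u * (54 * n ^ 3 + 168 * n ^ 2 + 249 * n + 98) +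
          u ^ 2 * (18 * n ^ 3 + 102 * n ^ 2 + 168 * n + 72)) := by ring
    rw [e]
    exact mul_le_mul_of_nonneg_left (by linarith) (sq_nonneg u)
  have t5 : 0 ≤ u ^ 5 * (63 * n ^ 3 + 210 * n ^ 2 + 196 * n + 56) := by positivity
  nlinarith [key, t, t5]

/-- Constant bookkeeping for Proposition 5.2, `res ∉ U` in case `m < K − 2` (with `128n·eps ≤ 1`).
[cite: Rump2009, proof of Proposition 5.2 (res ∉ U, cf. (4.41)–(4.42))] -/
theorem poly52bU {u n : ℚ} (hu0 : 0 < u) (hn : 2 ≤ n) (h128 : 128 * n * u ≤ 1) :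
    (2 * (1 - (3 * n + 2) * u) ^ 2 + (1 + 4 * u) * (1 - (3 * n + 2) * u) + 4 * (1 + u) * n * u) *
        (1 - 5 * u) ≤
      (1 - 2 * u - 4 * u ^ 2) * (1 - u) * (n + 2) * (1 - (3 * n + 2) * u) ^ 2 := by
  have hnn : 0 ≤ n := by linarith
  have hnu : n * u ≤ 1 / 128 := by linarith
  have hu : u ≤ 1 / 256 := by nlinarith
  -- margin = (n−1) − u(6n²+8n−7) + u²(9n³+30n²+3n−2) + u³(−27n³+12n²+32n)
  --          − u⁴(18n³+84n²+120n+48) + u⁵(36n³+120n²+112n+32)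
  have key : u * (6 * n ^ 2 + 8 * n - 7) ≤ n - 1 := by
    have h1 : 6 * n ^ 2 + 8 * n - 7 ≤ 128 * n * (n - 1) := by nlinarith
    have h2 : u * (6 * n ^ 2 + 8 * n - 7) ≤ u * (128 * n * (n - 1)) := mul_le_mul_of_nonneg_left h1 hu0.le
    have h3 : u * (128 * n * (n - 1)) = (n - 1) * (128 * n * u) := by ring
    have h4 : (n - 1) * (128 * n * u) ≤ (n - 1) * 1 := mul_le_mul_of_nonneg_left h128 (by linarith)
    linarith
  have b3 : u * (27 * n ^ 3) ≤ (9 * n ^ 3 + 30 * n ^ 2 + 3 * n - 2) / 2 := by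
    have e : u * (27 * n ^ 3) = (27 * n ^ 2) * (n * u) := by ring
    have h1 : (27 * n ^ 2) * (n * u) ≤ (27 * n ^ 2) * (1 / 128) :=
      mul_le_mul_of_nonneg_left hnu (by positivity)
    rw [e]; nlinarith [pow_nonneg hnn 3]
  have b4 : u ^ 2 * (18 * n ^ 3 + 84 * n ^ 2 + 120 * n + 48) ≤
      (9 * n ^ 3 + 30 * n ^ 2 + 3 * n - 2) / 2 := by
    have e : u ^ 2 * (18 * n ^ 3 + 84 * n ^ 2 + 120 * n + 48) =
        u * ((18 * n ^ 2 + 84 * n + 120) * (n * u) + 48 * u) := by ring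
    have h1 : (18 * n ^ 2 + 84 * n + 120) * (n * u) ≤ (18 * n ^ 2 + 84 * n + 120) * (1 / 128) :=
      mul_le_mul_of_nonneg_left hnu (by positivity)
    have h2 : u * ((18 * n ^ 2 + 84 * n + 120) * (n * u) + 48 * u) ≤
        1 / 256 * ((18 * n ^ 2 + 84 * n + 120) * (1 / 128) + 48 * (1 / 256)) := by
      apply mul_le_mul hu (by linarith) (by positivity) (by norm_num)
    rw [e]; nlinarith [pow_nonneg hnn 3]
  have t : u ^ 3 * (27 * n ^ 3) + u ^ 4 * (18 * n ^ 3 + 84 * n ^ 2 + 120 * n + 48) ≤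
      u ^ 2 * (9 * n ^ 3 + 30 * n ^ 2 + 3 * n - 2) := by
    have e : u ^ 3 * (27 * n ^ 3) + u ^ 4 * (18 * n ^ 3 + 84 * n ^ 2 + 120 * n + 48) =
        u ^ 2 * (u * (27 * n ^ 3) + u ^ 2 * (18 * n ^ 3 + 84 * n ^ 2 + 120 * n + 48)) := by ring
    rw [e]
    exact mul_le_mul_of_nonneg_left (by linarith) (sq_nonneg u)
  have t3 : 0 ≤ u ^ 3 * (12 * n ^ 2 + 32 * n) := by positivity
  have t5 : 0 ≤ u ^ 5 * (36 * n ^ 3 + 120 * n ^ 2 + 112 * n + 32) := by positivity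
  nlinarith [key, t, t3, t5]


/-! ### Proposition 5.2: the step from level `m` to level `m+1` -/

/-- **(5.11)**: `σ₀^(m+1) = fl(2T^(m)/(1 − (3n+1)eps))` with `T^(m) ≤ 2n·eps·ufp(σ₀^(m))` ((4.21)) and
`σ₀^(m+1) ∉ U` satisfies `σ₀^(m+1) ≤ 4nϕ·eps·ufp(σ₀^(m))`, `ϕ = (1 − (3n+2)eps)⁻¹` — multiplied out.
[cite: Rump2009, proof of Proposition 5.2 eq. (5.11)] -/
theorem sigmaZero_le_of_tBound_le (hp : 2 ≤ p) (he : emin + p ≤ 0) (hfl : IsRoundNearest p emin fl)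
    {n : ℕ} (hn : 4 * n + 2 ≤ 2 ^ p) {A T' : ℚ} (hT'F : IsFloat p emin T') (hT'0 : 0 ≤ T')
    (hT' : T' ≤ 2 * (n : ℚ) * unitRoundoff p * A)
    (hNU' : (2 : ℚ) ^ (emin + p - 1) < sigmaZero fl p n T') :
    (1 - (3 * (n : ℚ) + 2) * unitRoundoff p) * sigmaZero fl p n T' ≤
      4 * (n : ℚ) * unitRoundoff p * A := by
  have hp1 : 1 ≤ p := by omega
  set u := unitRoundoff p with hu
  have hu0 : 0 < u := u_pos
  have h3n : 3 * n + 1 ≤ 2 ^ p := by omega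
  have hcF : IsFloat p emin ((3 * (n : ℚ) + 1) * u) := by
    have := isFloat_natCast_mul_u (p := p) (emin := emin) hp1 (K := 3 * n + 1) h3n he
    push_cast at this; exact this
  have hc3F : IsFloat p emin (1 - (3 * (n : ℚ) + 1) * u) := by
    have := isFloat_one_sub_natCast_mul_u (p := p) (emin := emin) hp1 (K := 3 * n + 1) h3n he
    push_cast at this; exact this
  have h42 : (4 * (n : ℚ) + 2) * u ≤ 1 := by
    have := natCast_mul_u_le_one (p := p) (K := 4 * n + 2) hn
    push_cast at this; exact this
  have hnn : (0 : ℚ) ≤ n := Nat.cast_nonneg n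
  have hc0 : 0 < 1 - (3 * (n : ℚ) + 1) * u := by nlinarith
  have h2T : IsFloat p emin (2 * T') := isFloat_two_mul hT'F
  have hσ : sigmaZero fl p n T' = fl (2 * T' / (1 - (3 * (n : ℚ) + 1) * u)) := by
    rw [sigmaZero, ← hu, fl_eq_self hfl hcF, fl_eq_self hfl h2T, fl_eq_self hfl hc3F]
  set r := 2 * T' / (1 - (3 * (n : ℚ) + 1) * u) with hr
  have hr0 : 0 ≤ r := div_nonneg (by linarith) hc0.le
  rw [hσ] at hNU' ⊢
  have hflr0 : 0 ≤ fl r := fl_nonneg hfl hr0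
  have hth : (2 : ℚ) ^ (emin + p - 1) < |r| :=
    threshold_lt_abs_of_lt_abs_fl hp1 hfl (by rwa [abs_of_nonneg hflr0])
  have herr := abs_fl_sub_le_u_abs_fl hp1 hfl hth.le
  rw [abs_of_nonneg hflr0, ← hu] at herr
  have h1 : (1 - u) * fl r ≤ r := by
    have := (abs_sub_le_iff.mp herr).1; linarith
  have h2 : (1 - u) * fl r * (1 - (3 * (n : ℚ) + 1) * u) ≤ 2 * T' := by
    have := mul_le_mul_of_nonneg_right h1 hc0.le
    rwa [hr, div_mul_cancel₀ _ hc0.ne'] at this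
  have h3 : 0 ≤ (3 * (n : ℚ) + 1) * u ^ 2 * fl r := by positivity
  nlinarith [h2, h3, hT']

set_option maxHeartbeats 400000 in
/-- **Proposition 5.2, the case `m < K − 1`** (the stopping criterion `|t^(m)| ≥ Φ^(m)` holds at a
level `m` followed by at least one more level, and no underflow: `4T^(m) > eps⁻¹eta`,
`4T^(m+1) > eps⁻¹eta`), in the loop-state form of `FastAccSum`'s Lemma 4.9: state `(t, T, p)` =
`(t^(m−1), T^(m−1), p^(m−1))`, `σ₀ = σ₀^(m)`, `σ₀₁ = σ₀^(m+1)`, `t1 = t^(m)`, `τ₂` as printed,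
`τn1 = τ^(m+1)`, and an abstract last summand `TT ∈ F` with `Σᵢ pᵢ^(m+1) = TT + Δ`, `|TT| ≤ BT`,
`|Δ| ≤ BΔ`: then `res = fl(t^(m) + fl(τ₃ + fl(τ₄ + TT)))` is a faithful rounding of
`s = t + Σ pᵢ` PROVIDED the two displayed numeric conditions hold (they encode
`|res| > ½eps⁻¹eta` and `|res| − 2eps⁻¹|δ| > 0` for `δ = δ₃ + δ₄ + Δ`, via (5.5)–(5.10):
`τ₁ + τ₂ = t + τ^(m)`, `|τ₂| ≤ eps|t^(m)|`, `τ₃ + τ₄ = τ₂ + τ^(m+1)`, `|τ₄| ≤ eps|τ₃|`,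
`|τ^(m+1)| ≤ σ₀^(m+1)/2 < eps·σ₀^(m)` and Lemma 3.2). The printed proof bounds `eps⁻¹|δ|` using
`… + |Δ|` where (5.10) requires `… + eps⁻¹|Δ|`; the two instantiations below repair this.
[cite: Rump2009, Proposition 5.2 (proof, eqs. (5.5)–(5.10), (5.12)–(5.18) and the final estimate)] -/
theorem window_faithful (hp : 7 ≤ p) (he : emin + 2 * p ≤ 0) (hfl : IsRoundNearest p emin fl)
    {n : ℕ} (hn2 : 2 ≤ n) (hN : 2 * n ^ 2 + 4 * n + 6 ≤ 2 ^ p) {t T : ℚ} {xs : List ℚ}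
    (hinv : LoopInv p emin fl n t T xs) {σ0 : ℚ} (hσ0 : σ0 = sigmaZero fl p n T)
    (h49 : (2 : ℚ) ^ (emin + p) < 4 * tBound fl p n σ0)
    (hΦ : phiBound fl p n σ0 ≤ |fl (t + fl ((extractVectorNew fl σ0 xs).1 - σ0))|)
    {σ01 : ℚ} (hσ01 : σ01 = sigmaZero fl p n (tBound fl p n σ0))
    (h49' : (2 : ℚ) ^ (emin + p) < 4 * tBound fl p n σ01)
    {TT Δ BT BΔ : ℚ} (hTTF : IsFloat p emin TT)
    (hsplit : ((extractVectorNew fl σ01 (extractVectorNew fl σ0 xs).2).2).sum = TT + Δ)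
    (hBT : |TT| ≤ BT) (hBΔ : |Δ| ≤ BΔ)
    (hnumD : (unitRoundoff p * (3 + 8 * unitRoundoff p) * (σ01 / 2) + 5 * unitRoundoff p * BT +
        2 * BΔ) * (1 - 5 * unitRoundoff p) <
      unitRoundoff p * (1 - 5 * unitRoundoff p - 7 * unitRoundoff p ^ 2) * (1 - unitRoundoff p) *
        (2 * (n : ℚ) * ((n : ℚ) + 2) * unitRoundoff p * ufp σ0))
    (hnumU : (4 * (n : ℚ) * unitRoundoff p * ufp σ0 + (1 + 4 * unitRoundoff p) * (σ01 / 2) +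
        (1 + unitRoundoff p) * BT) * (1 - 5 * unitRoundoff p) ≤
      (1 - 2 * unitRoundoff p - 4 * unitRoundoff p ^ 2) * (1 - unitRoundoff p) *
        (2 * (n : ℚ) * ((n : ℚ) + 2) * unitRoundoff p * ufp σ0))
    {t1 τ2 τn1 : ℚ} (ht1 : t1 = fl (t + fl ((extractVectorNew fl σ0 xs).1 - σ0)))
    (hτ2 : τ2 = fl (fl (t - t1) + fl ((extractVectorNew fl σ0 xs).1 - σ0)))
    (hτn1 : τn1 = fl ((extractVectorNew fl σ01 (extractVectorNew fl σ0 xs).2).1 - σ01)) :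
    IsFaithfulRounding p emin
      (fl (t1 + fl (fl (τ2 + τn1) + fl (fl (fl (τ2 - fl (τ2 + τn1)) + τn1) + TT))))
      (t + xs.sum) := by
  have hp1 : 1 ≤ p := by omega
  have hp2 : 2 ≤ p := by omega
  have hp3 : 3 ≤ p := by omega
  have he1 : emin + p ≤ 0 := by omega
  obtain ⟨hu128, hNu, -, hNN, h11, -⟩ := format_facts hp hn2 hN
  have htF := hinv.tF
  have hgridt := hinv.grid
  obtain ⟨hσ0F, -, -, hps, hlen2, hflτ, hτF, -, hgridτ, hsum, hdisj, hT'F, hT'0, -, -, h49f⟩ :=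
    loop_facts hp he hfl hn2 hN hinv hσ0
  obtain ⟨hNU, hST', -, hT'M2⟩ := h49f h49
  rw [← hσ0] at hgridt
  rw [hflτ] at hΦ ht1 hτ2
  set u := unitRoundoff p with hu
  set τ := (extractVectorNew fl σ0 xs).1 - σ0 with hτ
  set ps := (extractVectorNew fl σ0 xs).2 with hps_def
  set Θ := (2 : ℚ) ^ (emin + p) with hΘ
  set T1 := tBound fl p n σ0 with hT1
  have hu0 : 0 < u := u_pos
  have hu1 : u ≤ 1 := u_le_one
  have hΘ0 : 0 < Θ := two_zpow_pos _
  have hhalf : (2 : ℚ) ^ (emin + p - 1) = Θ / 2 := by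
    rw [hΘ, zpow_sub_one₀ (two_ne_zero)]; ring
  have hn0 : (2 : ℚ) ≤ n := by exact_mod_cast hn2
  have hnn : (0 : ℚ) ≤ n := by linarith
  have h15 : 0 < 1 - 5 * u := by linarith
  have h1u : 0 ≤ 1 - u := by linarith
  have hu2 : u ^ 2 ≤ u / 128 := by nlinarith [hu0, hu128]
  have cpoly1 : (1 + u) * (1 + u + u ^ 2) ≤ 1 + 4 * u := by
    nlinarith [hu2, mul_le_mul_of_nonneg_left hu2 hu0.le]
  have cpos1 : 0 ≤ 1 - 2 * u - 4 * u ^ 2 := by linarith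
  have cpos2 : 0 ≤ 1 - 5 * u - 7 * u ^ 2 := by linarith
  have hBT0 : 0 ≤ BT := (abs_nonneg _).trans hBT
  have hBΔ0 : 0 ≤ BΔ := (abs_nonneg _).trans hBΔ
  -- level m: `[t^(m), τ₂] = FastTwoSum(t, τ^(m))` ((5.5))
  obtain ⟨h1, h12, -, hτ2u⟩ := fast2Sum_facts hp1 hfl htF hτF hdisj
  have hτ2eq : τ2 = (fast2Sum fl t τ).2 := by
    rw [hτ2, ht1]; exact printed_correction_eq hp1 hfl htF hτF hdisj
  set τ1 := (fast2Sum fl t τ).1 with hτ1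
  have ht1' : t1 = τ1 := by rw [ht1, h1]
  rw [ht1']
  rw [← h1] at hΦ
  rw [← hτ2eq] at h12 hτ2u
  have hτ1F : IsFloat p emin τ1 := by rw [h1]; exact (hfl _).1
  have hτ2F : IsFloat p emin τ2 := by rw [hτ2eq]; exact (hfl _).1
  -- level m+1 (state `(0, T^(m), p^(m))`): `τ^(m+1) = σ̃^(m+1) − σ₀^(m+1)` exact, `|τ^(m+1)| ≤ ½σ₀^(m+1)`
  have hinv1 : LoopInv p emin fl n 0 T1 ps :=
    ⟨fun y hy => (hps y hy).1, hlen2, hT'F, hST', isFloat_zero p emin, onGrid_zero _, by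
      rw [abs_zero, mul_zero]; positivity⟩
  obtain ⟨hσ01F, -, -, -, -, hflτn1, hτn1F, hτn1le, -, hsum1, -, -, -, -, -, h49f1⟩ :=
    loop_facts hp he hfl hn2 hN hinv1 hσ01
  obtain ⟨hNU1, -, -, -⟩ := h49f1 h49'
  rw [hflτn1] at hτn1
  set ps1 := (extractVectorNew fl σ01 ps).2 with hps1_def
  rw [← hτn1] at hτn1F hτn1le hsum1
  have hσ01half : σ01 ≤ ufp σ0 / 2 := by
    rw [hσ01]; exact sigmaZero_le_half_ufp hp2 he1 hfl h11 hNU hT'F hT'M2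
  -- `ufp(σ₀) = 2^k`, `Φ ≥ (1 − eps)q`, `q(1 − 5eps) = 2n(n+2)eps·ufp(σ₀)` as in Lemma 4.10 / (4.40)
  have hσ0pos : 0 < σ0 := lt_trans (two_zpow_pos _) hNU
  obtain ⟨k, hk⟩ := exists_ufp_eq_two_zpow hσ0pos.ne'
  have hufp0 : 0 < ufp σ0 := by rw [hk]; exact two_zpow_pos _
  have hufpσ0 : ufp σ0 ≤ σ0 := by
    have := ufp_le_abs σ0; rwa [abs_of_pos hσ0pos] at this
  have hM2Θ : Θ / 4 < 2 * (n : ℚ) * u * ufp σ0 := by linarith [hT'M2, h49]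
  obtain ⟨q, -, hqM, hMq, -, hqb⟩ := phiBound_facts hp3 he1 hfl hNN hσ0F hNU
  have hM20 : 0 ≤ 2 * (n : ℚ) * u * ufp σ0 := by positivity
  have hqth : (2 : ℚ) ^ (emin + p - 1) ≤ q := by
    rw [hhalf]
    linarith [hMq, hM2Θ, mul_nonneg (sub_nonneg.2 hn0) hM20]
  obtain ⟨hΦlo, -⟩ := hqb hqth
  have g5 : (1 - u) * q ≤ |τ1| := hΦlo.trans hΦ
  -- `[τ₃, τ₄] = FastTwoSum(τ₂, τ^(m+1))` is applicable: `τ₂ = t + τ^(m) − t^(m) ∈ eps·ufp(σ₀^(m))ℤ`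
  have hdisj1 : τn1 = 0 ∨ OnGrid (2 * u * ufp τn1) τ2 := by
    by_cases h0 : τn1 = 0
    · exact Or.inl h0
    · right
      have hg2 : OnGrid (u * ufp σ0) τ2 := by
        rw [hk] at hgridt hgridτ ⊢
        obtain ⟨-, -, h3⟩ := onGrid_fl_add hp1 hfl hgridt hgridτ
        have e : τ2 = -(fl (t + τ) - (t + τ)) := by rw [← h1]; linarith [h12]
        rw [e]; exact h3.neg
      exact onGrid_two_u_ufp_of_onGrid_u_ufp hσ0pos h0 (by linarith [hτn1le, hσ01half, hufpσ0]) hg2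
  obtain ⟨h1', h34, -, hτ4u⟩ := fast2Sum_facts hp1 hfl hτ2F hτn1F hdisj1
  have hτ4eq : fl (fl (τ2 - fl (τ2 + τn1)) + τn1) = (fast2Sum fl τ2 τn1).2 :=
    printed_correction_eq hp1 hfl hτ2F hτn1F hdisj1
  rw [hτ4eq, ← h1']
  set τ3 := (fast2Sum fl τ2 τn1).1 with hτ3
  set τ4 := (fast2Sum fl τ2 τn1).2 with hτ4
  have hτ3F : IsFloat p emin τ3 := by rw [h1']; exact (hfl _).1
  have hτ4F : IsFloat p emin τ4 := (hfl _).1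
  -- (5.5)–(5.8) in magnitude form
  have g1 : |τ2| ≤ u * |τ1| := hτ2u.trans (mul_le_mul_of_nonneg_left (ufp_le_abs _) hu0.le)
  have g2 : |τ4| ≤ u * |τ3| := hτ4u.trans (mul_le_mul_of_nonneg_left (ufp_le_abs _) hu0.le)
  have gy : (1 - u) * |τ3| ≤ u * |τ1| + |τn1| := by
    have e : τ3 = τ2 + τn1 - τ4 := by linarith [h34]
    have : |τ3| ≤ |τ2| + |τn1| + |τ4| := by
      rw [e]; exact (abs_sub _ _).trans (by linarith only [abs_add_le τ2 τn1])
    linarith only [this, g1, g2]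
  -- `τ₄' = fl(τ₄ + TT) = τ₄ + TT − δ₄`, `τ₃' = fl(τ₃ + τ₄') = τ₃ + τ₄' − δ₃`  ((5.9))
  set τ4' := fl (τ4 + TT) with hτ4'
  set τ3' := fl (τ3 + τ4') with hτ3'
  have hτ4'F : IsFloat p emin τ4' := (hfl _).1
  have hτ3'F : IsFloat p emin τ3' := (hfl _).1
  have d4 : |τ4' - (τ4 + TT)| ≤ u * (u * |τ3|) + u * BT := by
    have m1 : u * |τ4| ≤ u * (u * |τ3|) := mul_le_mul_of_nonneg_left g2 hu0.le
    have m2 : u * |TT| ≤ u * BT := mul_le_mul_of_nonneg_left hBT hu0.le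
    calc |τ4' - (τ4 + TT)| ≤ u * ufp (τ4 + TT) := abs_fl_add_sub_le_u_ufp hp1 hfl hτ4F hTTF
      _ ≤ u * |τ4 + TT| := mul_le_mul_of_nonneg_left (ufp_le_abs _) hu0.le
      _ ≤ u * (|τ4| + |TT|) := mul_le_mul_of_nonneg_left (abs_add_le _ _) hu0.le
      _ ≤ u * (u * |τ3|) + u * BT := by linarith only [m1, m2]
  have w4 : |τ4'| ≤ (1 + u) * (u * |τ3| + BT) := by
    have h' : |τ4'| ≤ |τ4 + TT| + |τ4' - (τ4 + TT)| := by
      have := abs_add_le (τ4 + TT) (τ4' - (τ4 + TT))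
      rwa [show τ4 + TT + (τ4' - (τ4 + TT)) = τ4' by ring] at this
    linarith only [h', abs_add_le τ4 TT, g2, hBT, d4]
  have d3 : |τ3' - (τ3 + τ4')| ≤ u * |τ3| + u * |τ4'| := by
    calc |τ3' - (τ3 + τ4')| ≤ u * ufp (τ3 + τ4') := abs_fl_add_sub_le_u_ufp hp1 hfl hτ3F hτ4'F
      _ ≤ u * |τ3 + τ4'| := mul_le_mul_of_nonneg_left (ufp_le_abs _) hu0.le
      _ ≤ u * (|τ3| + |τ4'|) := mul_le_mul_of_nonneg_left (abs_add_le _ _) hu0.le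
      _ = u * |τ3| + u * |τ4'| := by ring
  have w3 : |τ3'| ≤ (1 + u) * (|τ3| + |τ4'|) := by
    have h' : |τ3'| ≤ |τ3 + τ4'| + |τ3' - (τ3 + τ4')| := by
      have := abs_add_le (τ3 + τ4') (τ3' - (τ3 + τ4'))
      rwa [show τ3 + τ4' + (τ3' - (τ3 + τ4')) = τ3' by ring] at this
    linarith only [h', abs_add_le τ3 τ4', d3]
  -- `res = fl(t^(m) + τ₃')`, `|res| ≥ (1 − eps)|t^(m) + τ₃'|`  ((2.5))
  have hres : (1 - u) * |τ1 + τ3'| ≤ |fl (τ1 + τ3')| := one_sub_u_mul_abs_add_le hp1 hfl hτ1F hτ3'F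
  have F8 : (1 - u) * (|τ1| - |τ3'|) ≤ |fl (τ1 + τ3')| := by
    have htri : |τ1| - |τ3'| ≤ |τ1 + τ3'| := by
      have := abs_add_le (τ1 + τ3') (-τ3')
      rw [abs_neg, show τ1 + τ3' + -τ3' = τ1 by ring] at this
      linarith only [this]
    have := mul_le_mul_of_nonneg_left htri h1u
    linarith only [this, hres]
  -- `|res| ≥ (1 − 2eps − 4eps²)|t^(m)| − (1 + 4eps)|τ^(m+1)| − (1 + eps)BT`
  have hR : (1 - 2 * u - 4 * u ^ 2) * |τ1| - (1 + 4 * u) * |τn1| - (1 + u) * BT ≤ |fl (τ1 + τ3')| := by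
    have e7 : (1 - u) * |τ3'| ≤ (1 - u) * ((1 + u) * (|τ3| + |τ4'|)) := mul_le_mul_of_nonneg_left w3 h1u
    have e6 : (1 - u) * (1 + u) * |τ4'| ≤ (1 - u) * (1 + u) * ((1 + u) * (u * |τ3| + BT)) :=
      mul_le_mul_of_nonneg_left w4 (mul_nonneg h1u (by linarith))
    have e4 : (1 + u) * (1 + u + u ^ 2) * ((1 - u) * |τ3|) ≤
        (1 + u) * (1 + u + u ^ 2) * (u * |τ1| + |τn1|) :=
      mul_le_mul_of_nonneg_left gy (by positivity)
    have c1 : (1 + u) * (1 + u + u ^ 2) * (u * |τ1| + |τn1|) ≤ (1 + 4 * u) * (u * |τ1| + |τn1|) :=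
      mul_le_mul_of_nonneg_right cpoly1 (by positivity)
    have c2 : (1 - u) * (1 + u) * ((1 + u) * BT) ≤ (1 + u) * BT := by
      have : 0 ≤ u ^ 2 * (1 + u) * BT := by positivity
      linarith only [this]
    linarith only [F8, e7, e6, e4, c1, c2]
  -- `res ∉ U`
  have hU : Θ / 2 < |fl (τ1 + τ3')| := by
    have e1 : (1 - 2 * u - 4 * u ^ 2) * ((1 - u) * q) ≤ (1 - 2 * u - 4 * u ^ 2) * |τ1| :=
      mul_le_mul_of_nonneg_left g5 cpos1
    have e5 : (1 + 4 * u) * |τn1| ≤ (1 + 4 * u) * (σ01 / 2) :=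
      mul_le_mul_of_nonneg_left hτn1le (by linarith)
    have hL : (1 - 2 * u - 4 * u ^ 2) * ((1 - u) * q) - (1 + 4 * u) * (σ01 / 2) - (1 + u) * BT ≤
        |fl (τ1 + τ3')| := by linarith only [hR, e1, e5]
    have hL' := mul_le_mul_of_nonneg_left hL h15.le
    have eqM : (1 - 5 * u) * ((1 - 2 * u - 4 * u ^ 2) * ((1 - u) * q)) =
        (1 - 2 * u - 4 * u ^ 2) * (1 - u) * (2 * (n : ℚ) * ((n : ℚ) + 2) * u * ufp σ0) := by
      rw [← hqM]; ring
    have f3 : 2 * (1 - 5 * u) * (Θ / 4) < 2 * (1 - 5 * u) * (2 * (n : ℚ) * u * ufp σ0) :=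
      mul_lt_mul_of_pos_left hM2Θ (by linarith)
    have : (1 - 5 * u) * (Θ / 2) < (1 - 5 * u) * |fl (τ1 + τ3')| := by
      linarith only [hL', eqM, hnumU, f3]
    exact lt_of_mul_lt_mul_left this h15.le
  -- `|res| − 2eps⁻¹|δ| > 0` for `δ = δ₃ + δ₄ + Δ`  ((5.10))
  have hδ : 2 * |(τ3 + τ4' - τ3') + (τ4 + TT - τ4') + Δ| < u * |fl (τ1 + τ3')| := by
    have q2 : |(τ3 + τ4' - τ3') + (τ4 + TT - τ4') + Δ| ≤
        |τ3 + τ4' - τ3'| + |τ4 + TT - τ4'| + |Δ| :=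
      (abs_add_le _ _).trans (by linarith only [abs_add_le (τ3 + τ4' - τ3') (τ4 + TT - τ4')])
    have d3' : |τ3 + τ4' - τ3'| ≤ u * |τ3| + u * |τ4'| := by rw [abs_sub_comm]; exact d3
    have d4' : |τ4 + TT - τ4'| ≤ u * (u * |τ3|) + u * BT := by rw [abs_sub_comm]; exact d4
    have uR : u * ((1 - u) * (|τ1| - |τ3'|)) ≤ u * |fl (τ1 + τ3')| :=
      mul_le_mul_of_nonneg_left F8 hu0.le
    have e7u : u * (1 - u) * |τ3'| ≤ u * (1 - u) * ((1 + u) * (|τ3| + |τ4'|)) :=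
      mul_le_mul_of_nonneg_left w3 (mul_nonneg hu0.le h1u)
    have c3 : u * (1 - u) * ((1 + u) * (|τ3| + |τ4'|)) ≤ u * (|τ3| + |τ4'|) := by
      have : 0 ≤ u * u ^ 2 * (|τ3| + |τ4'|) := by positivity
      linarith only [this]
    have f6 : 3 * u * |τ4'| ≤ 3 * u * ((1 + u) * (u * |τ3| + BT)) :=
      mul_le_mul_of_nonneg_left w4 (by positivity)
    have hL2 : u * (1 - u) * |τ1| - (3 * u + 5 * u ^ 2 + 3 * u ^ 3) * |τ3| -
        (5 * u + 3 * u ^ 2) * BT - 2 * BΔ ≤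
        u * |fl (τ1 + τ3')| - 2 * |(τ3 + τ4' - τ3') + (τ4 + TT - τ4') + Δ| := by
      linarith only [q2, d3', d4', hBΔ, uR, e7u, c3, f6]
    have f4 : (3 * u + 5 * u ^ 2 + 3 * u ^ 3) * ((1 - u) * |τ3|) ≤
        (3 * u + 5 * u ^ 2 + 3 * u ^ 3) * (u * |τ1| + |τn1|) :=
      mul_le_mul_of_nonneg_left gy (by positivity)
    have c4 : (3 * u + 5 * u ^ 2 + 3 * u ^ 3) * |τn1| ≤ u * (3 + 8 * u) * |τn1| := by
      have : 0 ≤ u ^ 2 * (1 - u) * |τn1| := mul_nonneg (mul_nonneg (sq_nonneg u) h1u) (abs_nonneg _)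
      linarith only [this]
    have c5 : (1 - u) * ((5 * u + 3 * u ^ 2) * BT) ≤ 5 * u * BT := by
      have : 0 ≤ u ^ 2 * (2 + 3 * u) * BT := by positivity
      linarith only [this]
    have c6 : (1 - u) * (2 * BΔ) ≤ 2 * BΔ := by
      have : 0 ≤ u * BΔ := by positivity
      linarith only [this]
    have c7 : u * (1 - 5 * u - 7 * u ^ 2) * |τ1| ≤ u * (1 - 5 * u - 4 * u ^ 2 - 3 * u ^ 3) * |τ1| := by
      have : 0 ≤ u * (3 * u ^ 2 * (1 - u)) * |τ1| :=
        mul_nonneg (mul_nonneg hu0.le (mul_nonneg (by positivity) h1u)) (abs_nonneg _)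
      linarith only [this]
    have e8 : u * (1 - 5 * u - 7 * u ^ 2) * ((1 - u) * q) ≤ u * (1 - 5 * u - 7 * u ^ 2) * |τ1| :=
      mul_le_mul_of_nonneg_left g5 (mul_nonneg hu0.le cpos2)
    have e9 : u * (3 + 8 * u) * |τn1| ≤ u * (3 + 8 * u) * (σ01 / 2) :=
      mul_le_mul_of_nonneg_left hτn1le (by positivity)
    have eqM' : (1 - 5 * u) * (u * (1 - 5 * u - 7 * u ^ 2) * ((1 - u) * q)) =
        u * (1 - 5 * u - 7 * u ^ 2) * (1 - u) * (2 * (n : ℚ) * ((n : ℚ) + 2) * u * ufp σ0) := by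
      rw [← hqM]; ring
    have hL4pos : 0 < u * (1 - 5 * u - 7 * u ^ 2) * ((1 - u) * q) - u * (3 + 8 * u) * (σ01 / 2) -
        5 * u * BT - 2 * BΔ := by
      by_contra hcon
      have hmul := mul_le_mul_of_nonneg_left (not_lt.mp hcon) h15.le
      rw [mul_zero] at hmul
      linarith only [eqM', hnumD, hmul]
    have hpos : 0 < (1 - u) * (u * (1 - u) * |τ1| - (3 * u + 5 * u ^ 2 + 3 * u ^ 3) * |τ3| -
        (5 * u + 3 * u ^ 2) * BT - 2 * BΔ) := by
      linarith only [f4, c4, c5, c6, c7, e8, e9, hL4pos]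
    have hL2pos : 0 < u * (1 - u) * |τ1| - (3 * u + 5 * u ^ 2 + 3 * u ^ 3) * |τ3| -
        (5 * u + 3 * u ^ 2) * BT - 2 * BΔ := by
      have h' : (1 - u) * 0 < (1 - u) * (u * (1 - u) * |τ1| - (3 * u + 5 * u ^ 2 + 3 * u ^ 3) * |τ3| -
          (5 * u + 3 * u ^ 2) * BT - 2 * BΔ) := by rwa [mul_zero]
      exact lt_of_mul_lt_mul_left h' h1u
    linarith only [hL2, hL2pos]
  -- Lemma 3.2
  have hfaith := isFaithfulRounding_fl_of_not_mem_U hp1 hfl (r := τ1 + τ3')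
    (δ := (τ3 + τ4' - τ3') + (τ4 + TT - τ4') + Δ) (by rw [hhalf]; exact hU) hδ
  have heq : t + xs.sum = τ1 + τ3' + ((τ3 + τ4' - τ3') + (τ4 + TT - τ4') + Δ) := by
    rw [hsum, hsum1, hsplit]; linarith only [h12, h34]
  rw [heq]
  exact hfaith

set_option maxHeartbeats 400000 in
/-- **Proposition 5.2, case `m = K − 2`**: with `T := fl(Σ pᵢ^(m+1))` (the algorithm's `e`) and
`Δ := Σ pᵢ^(m+1) − T` ((5.4)), `|pᵢ^(m+1)| ≤ eps·σ₀^(m+1)`, `|T| ≤ n·eps·σ₀^(m+1)` ((5.12)),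
`|Δ| ≤ ½n(n−1)eps·eps·σ₀^(m+1)` ((5.13), (2.19)), and (5.11): `res = fl(t^(m) + fl(τ₃ + fl(τ₄ + e)))`
is a faithful rounding of `s`. Loop-state form as in `window_faithful`.
[cite: Rump2009, Proposition 5.2 (case m = K−2: eqs. (5.4), (5.11)–(5.13) and the final estimate)] -/
theorem fired_caseA_faithful (hp : 7 ≤ p) (he : emin + 2 * p ≤ 0) (hfl : IsRoundNearest p emin fl)
    {n : ℕ} (hn2 : 2 ≤ n) (hN : 2 * n ^ 2 + 4 * n + 6 ≤ 2 ^ p) {t T : ℚ} {xs : List ℚ}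
    (hinv : LoopInv p emin fl n t T xs) {σ0 : ℚ} (hσ0 : σ0 = sigmaZero fl p n T)
    (h49 : (2 : ℚ) ^ (emin + p) < 4 * tBound fl p n σ0)
    (hΦ : phiBound fl p n σ0 ≤ |fl (t + fl ((extractVectorNew fl σ0 xs).1 - σ0))|)
    {σ01 : ℚ} (hσ01 : σ01 = sigmaZero fl p n (tBound fl p n σ0))
    (h49' : (2 : ℚ) ^ (emin + p) < 4 * tBound fl p n σ01)
    {t1 τ2 τn1 : ℚ} (ht1 : t1 = fl (t + fl ((extractVectorNew fl σ0 xs).1 - σ0)))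
    (hτ2 : τ2 = fl (fl (t - t1) + fl ((extractVectorNew fl σ0 xs).1 - σ0)))
    (hτn1 : τn1 = fl ((extractVectorNew fl σ01 (extractVectorNew fl σ0 xs).2).1 - σ01)) :
    IsFaithfulRounding p emin
      (fl (t1 + fl (fl (τ2 + τn1) + fl (fl (fl (τ2 - fl (τ2 + τn1)) + τn1) +
        flSum fl (extractVectorNew fl σ01 (extractVectorNew fl σ0 xs).2).2))))
      (t + xs.sum) := by
  have hp1 : 1 ≤ p := by omega
  have hp2 : 2 ≤ p := by omega
  have he1 : emin + p ≤ 0 := by omega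
  obtain ⟨hu128, hNu, h42, -, -, hnle⟩ := format_facts hp hn2 hN
  obtain ⟨-, -, -, hps, hlen2, -, -, -, -, -, -, hT'F, hT'0, -, -, h49f⟩ :=
    loop_facts hp he hfl hn2 hN hinv hσ0
  obtain ⟨hNU, hST', -, hT'M2⟩ := h49f h49
  set u := unitRoundoff p with hu
  set ps := (extractVectorNew fl σ0 xs).2 with hps_def
  set T1 := tBound fl p n σ0 with hT1
  have hu0 : 0 < u := u_pos
  have hn0 : (2 : ℚ) ≤ n := by exact_mod_cast hn2
  have hnn : (0 : ℚ) ≤ n := by linarith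
  have h15 : 0 ≤ 1 - 5 * u := by linarith
  have hu2 : u ^ 2 ≤ u / 128 := by nlinarith [hu0, hu128]
  have cpos2 : 0 ≤ 1 - 5 * u - 7 * u ^ 2 := by linarith
  have hinv1 : LoopInv p emin fl n 0 T1 ps :=
    ⟨fun y hy => (hps y hy).1, hlen2, hT'F, hST', isFloat_zero p emin, onGrid_zero _, by
      rw [abs_zero, mul_zero]; positivity⟩
  obtain ⟨-, -, -, hps1, hlen3, -, -, -, -, -, -, -, -, -, -, h49f1⟩ :=
    loop_facts hp he hfl hn2 hN hinv1 hσ01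
  obtain ⟨hNU1, -, -, -⟩ := h49f1 h49'
  set ps1 := (extractVectorNew fl σ01 ps).2 with hps1_def
  -- `ufp(σ₀) > 0`, `ufp(σ₀^(m+1)) = 2^k₁ ≤ σ₀^(m+1)`, `|pᵢ^(m+1)| ≤ eps·σ₀^(m+1) = 2^(k₁−p+1)`
  have hσ0pos : 0 < σ0 := lt_trans (two_zpow_pos _) hNU
  have hufp0 : 0 < ufp σ0 := lt_of_lt_of_le (two_zpow_pos _) (two_zpow_le_ufp (le_abs.2 (Or.inl hNU.le)))
  have hσ01pos : 0 < σ01 := lt_trans (two_zpow_pos _) hNU1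
  obtain ⟨k1, hk1⟩ := exists_ufp_eq_two_zpow hσ01pos.ne'
  have hk1e : emin + p - 1 ≤ k1 := by
    have h1 : (2 : ℚ) ^ (emin + p - 1) ≤ ufp σ01 := two_zpow_le_ufp (le_abs.2 (Or.inl hNU1.le))
    rw [hk1] at h1
    exact (zpow_le_zpow_iff_right₀ (by norm_num : (1 : ℚ) < 2)).mp h1
  have hA1 : ufp σ01 ≤ σ01 := by
    have := ufp_le_abs σ01; rwa [abs_of_pos hσ01pos] at this
  have hA10 : 0 ≤ ufp σ01 := ufp_nonneg σ01
  have hj : emin ≤ k1 - p + 1 := by omega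
  have h2j : (2 : ℚ) ^ (k1 - p + 1) = 2 * u * ufp σ01 := by rw [hk1, hu, two_mul_u_mul_two_zpow]
  have hps1' : ∀ y ∈ ps1, IsFloat p emin y ∧ |y| ≤ (2 : ℚ) ^ (k1 - p + 1) :=
    fun y hy => ⟨(hps1 y hy).1, by rw [h2j]; exact (hps1 y hy).2⟩
  obtain ⟨hTTa, hΔa⟩ := flSum_bounds_of_abs_le hp1 hfl hj hps1' (by rw [hlen3]; exact hnle)
  rw [hlen3, h2j] at hTTa hΔa
  rw [abs_sub_comm] at hΔa
  have hTTF : IsFloat p emin (flSum fl ps1) := isFloat_flSum hfl fun y hy => (hps1 y hy).1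
  -- (5.11)
  have h511 : (1 - (3 * (n : ℚ) + 2) * u) * σ01 ≤ 4 * (n : ℚ) * u * ufp σ0 := by
    rw [hσ01]
    exact sigmaZero_le_of_tBound_le hp2 he1 hfl h42 hT'F hT'0 hT'M2 (by rw [← hσ01]; exact hNU1)
  -- the numeric conditions of `window_faithful`
  have hpoly := poly52a hu0 hu128 hn0 hNu
  have hpolyU := poly52aU hu0 hu128 hn0 hNu
  have hnumD : (u * (3 + 8 * u) * (σ01 / 2) + 5 * u * ((n : ℚ) * (2 * u * ufp σ01)) +
      2 * ((n : ℚ) * ((n : ℚ) - 1) / 2 * u * (2 * u * ufp σ01))) * (1 - 5 * u) <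
      u * (1 - 5 * u - 7 * u ^ 2) * (1 - u) * (2 * (n : ℚ) * ((n : ℚ) + 2) * u * ufp σ0) := by
    have m1 : (1 - 5 * u) * (5 * u) * ((n : ℚ) * (2 * u * ufp σ01)) ≤
        (1 - 5 * u) * (5 * u) * ((n : ℚ) * (2 * u * σ01)) :=
      mul_le_mul_of_nonneg_left (mul_le_mul_of_nonneg_left
        (mul_le_mul_of_nonneg_left hA1 (by positivity)) hnn) (by positivity)
    have m2 : (1 - 5 * u) * 2 * ((n : ℚ) * ((n : ℚ) - 1) / 2 * u * (2 * u * ufp σ01)) ≤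
        (1 - 5 * u) * 2 * ((n : ℚ) * ((n : ℚ) - 1) / 2 * u * (2 * u * σ01)) :=
      mul_le_mul_of_nonneg_left (mul_le_mul_of_nonneg_left
        (mul_le_mul_of_nonneg_left hA1 (by positivity)) (by
          have : (0 : ℚ) ≤ (n : ℚ) - 1 := by linarith
          positivity)) (by positivity)
    have s2 : u * (σ01 / 2) * ((3 + 8 * u + 20 * n * u + 4 * n * (n - 1) * u) * (1 - 5 * u)) <
        u * (σ01 / 2) * ((1 - 5 * u - 7 * u ^ 2) * (1 - u) * (n + 2) * (1 - (3 * n + 2) * u)) :=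
      mul_lt_mul_of_pos_left hpoly (by positivity)
    have s3 : u * (1 - 5 * u - 7 * u ^ 2) * (1 - u) * ((n : ℚ) + 2) / 2 *
        ((1 - (3 * (n : ℚ) + 2) * u) * σ01) ≤
        u * (1 - 5 * u - 7 * u ^ 2) * (1 - u) * ((n : ℚ) + 2) / 2 * (4 * (n : ℚ) * u * ufp σ0) :=
      mul_le_mul_of_nonneg_left h511 (by
        have : 0 ≤ 1 - u := by linarith
        positivity)
    linarith only [m1, m2, s2, s3]
  have hnumU : (4 * (n : ℚ) * u * ufp σ0 + (1 + 4 * u) * (σ01 / 2) +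
      (1 + u) * ((n : ℚ) * (2 * u * ufp σ01))) * (1 - 5 * u) ≤
      (1 - 2 * u - 4 * u ^ 2) * (1 - u) * (2 * (n : ℚ) * ((n : ℚ) + 2) * u * ufp σ0) := by
    have u1 : (1 + u) * (1 - 5 * u) * ((n : ℚ) * (2 * u * ufp σ01)) ≤
        (1 + u) * (1 - 5 * u) * ((n : ℚ) * (2 * u * σ01)) :=
      mul_le_mul_of_nonneg_left (mul_le_mul_of_nonneg_left
        (mul_le_mul_of_nonneg_left hA1 (by positivity)) hnn) (by positivity)
    have pU : σ01 / 2 * ((2 * (1 - (3 * n + 2) * u) + (1 + 4 * u) + 4 * (1 + u) * n * u) * (1 - 5 * u)) ≤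
        σ01 / 2 * ((1 - 2 * u - 4 * u ^ 2) * (1 - u) * (n + 2) * (1 - (3 * n + 2) * u)) :=
      mul_le_mul_of_nonneg_left hpolyU (by positivity)
    have a : 1 / 2 ≤ (1 - 2 * u - 4 * u ^ 2) * (1 - u) := by
      have u3 : 0 ≤ u ^ 3 := by positivity
      linarith only [hu2, hu128, u3]
    have b := mul_le_mul_of_nonneg_right a (by linarith : (0 : ℚ) ≤ (n : ℚ) + 2)
    have hG0 : 0 ≤ ((1 - 2 * u - 4 * u ^ 2) * (1 - u) * ((n : ℚ) + 2) - 2 * (1 - 5 * u)) / 2 := by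
      linarith only [b, hn0, hu0]
    have hG : ((1 - 2 * u - 4 * u ^ 2) * (1 - u) * ((n : ℚ) + 2) - 2 * (1 - 5 * u)) / 2 *
        ((1 - (3 * (n : ℚ) + 2) * u) * σ01) ≤
        ((1 - 2 * u - 4 * u ^ 2) * (1 - u) * ((n : ℚ) + 2) - 2 * (1 - 5 * u)) / 2 *
        (4 * (n : ℚ) * u * ufp σ0) := mul_le_mul_of_nonneg_left h511 hG0
    linarith only [u1, pU, hG]
  exact window_faithful hp he hfl hn2 hN hinv hσ0 h49 hΦ hσ01 h49' hTTF (Δ := ps1.sum - flSum fl ps1)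
    (by ring) hTTa hΔa hnumD hnumU ht1 hτ2 hτn1

set_option maxHeartbeats 400000 in
/-- **Proposition 5.2, case `m < K − 2`**: with `T := τ^(m+2) = σ̃^(m+2) − σ₀^(m+2)`,
`Δ := Σ pᵢ^(m+2)` ((5.4)), `|pᵢ^(m+2)| ≤ eps·σ₀^(m+2)`, `|T| < eps·σ₀^(m+1)` and `σ₀^(m+2)`
controlled by (5.11) applied twice ((5.14)–(5.15)): `res = fl(t^(m) + fl(τ₃ + fl(τ₄ + τ^(m+2))))`
is a faithful rounding of `s`. This formalisation needs the ADDITIONAL hypothesis `128n·eps ≤ 1`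
here (automatic for `n ≥ 62` under `(2n²+4n+6)eps ≤ 1`; see the file header, note (b)): with the
printed constants alone the final estimate fails for small `n` once `eps⁻¹|Δ|` is accounted for.
[cite: Rump2009, Proposition 5.2 (case m < K−2: eqs. (5.4), (5.11), (5.14)–(5.15) and the final estimate)] -/
theorem fired_caseB_faithful (hp : 7 ≤ p) (he : emin + 2 * p ≤ 0) (hfl : IsRoundNearest p emin fl)
    {n : ℕ} (hn2 : 2 ≤ n) (hN : 2 * n ^ 2 + 4 * n + 6 ≤ 2 ^ p) (h128 : 128 * n ≤ 2 ^ p)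
    {t T : ℚ} {xs : List ℚ}
    (hinv : LoopInv p emin fl n t T xs) {σ0 : ℚ} (hσ0 : σ0 = sigmaZero fl p n T)
    (h49 : (2 : ℚ) ^ (emin + p) < 4 * tBound fl p n σ0)
    (hΦ : phiBound fl p n σ0 ≤ |fl (t + fl ((extractVectorNew fl σ0 xs).1 - σ0))|)
    {σ01 : ℚ} (hσ01 : σ01 = sigmaZero fl p n (tBound fl p n σ0))
    (h49' : (2 : ℚ) ^ (emin + p) < 4 * tBound fl p n σ01)
    {σ02 : ℚ} (hσ02 : σ02 = sigmaZero fl p n (tBound fl p n σ01))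
    (h49'' : (2 : ℚ) ^ (emin + p) < 4 * tBound fl p n σ02)
    {t1 τ2 τn1 τn2 : ℚ} (ht1 : t1 = fl (t + fl ((extractVectorNew fl σ0 xs).1 - σ0)))
    (hτ2 : τ2 = fl (fl (t - t1) + fl ((extractVectorNew fl σ0 xs).1 - σ0)))
    (hτn1 : τn1 = fl ((extractVectorNew fl σ01 (extractVectorNew fl σ0 xs).2).1 - σ01))
    (hτn2 : τn2 = fl ((extractVectorNew fl σ02
      (extractVectorNew fl σ01 (extractVectorNew fl σ0 xs).2).2).1 - σ02)) :
    IsFaithfulRounding p emin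
      (fl (t1 + fl (fl (τ2 + τn1) + fl (fl (fl (τ2 - fl (τ2 + τn1)) + τn1) + τn2))))
      (t + xs.sum) := by
  have hp1 : 1 ≤ p := by omega
  have hp2 : 2 ≤ p := by omega
  have he1 : emin + p ≤ 0 := by omega
  obtain ⟨hu128, -, h42, -, -, -⟩ := format_facts hp hn2 hN
  obtain ⟨-, -, -, hps, hlen2, -, -, -, -, -, -, hT'F, hT'0, -, -, h49f⟩ :=
    loop_facts hp he hfl hn2 hN hinv hσ0
  obtain ⟨hNU, hST', -, hT'M2⟩ := h49f h49
  set u := unitRoundoff p with hu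
  set ps := (extractVectorNew fl σ0 xs).2 with hps_def
  set T1 := tBound fl p n σ0 with hT1
  have hu0 : 0 < u := u_pos
  have hn0 : (2 : ℚ) ≤ n := by exact_mod_cast hn2
  have hnn : (0 : ℚ) ≤ n := by linarith
  have h15 : 0 ≤ 1 - 5 * u := by linarith
  have h128q : 128 * (n : ℚ) * u ≤ 1 := by
    have := natCast_mul_u_le_one (p := p) (K := 128 * n) h128
    push_cast at this; rw [← hu] at this; exact this
  have hinv1 : LoopInv p emin fl n 0 T1 ps :=
    ⟨fun y hy => (hps y hy).1, hlen2, hT'F, hST', isFloat_zero p emin, onGrid_zero _, by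
      rw [abs_zero, mul_zero]; positivity⟩
  obtain ⟨-, -, -, hps1, hlen3, -, -, -, -, -, -, hT2F, hT20, -, -, h49f1⟩ :=
    loop_facts hp he hfl hn2 hN hinv1 hσ01
  obtain ⟨hNU1, hST2, -, hT2M2⟩ := h49f1 h49'
  set ps1 := (extractVectorNew fl σ01 ps).2 with hps1_def
  set T2 := tBound fl p n σ01 with hT2
  have hinv2 : LoopInv p emin fl n 0 T2 ps1 :=
    ⟨fun y hy => (hps1 y hy).1, hlen3, hT2F, hST2, isFloat_zero p emin, onGrid_zero _, by
      rw [abs_zero, mul_zero]; positivity⟩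
  obtain ⟨-, -, -, hps2, hlen4, hflτn2, hτn2F, hτn2le, -, hsum2, -, -, -, -, -, h49f2⟩ :=
    loop_facts hp he hfl hn2 hN hinv2 hσ02
  obtain ⟨hNU2, -, -, -⟩ := h49f2 h49''
  set ps2 := (extractVectorNew fl σ02 ps1).2 with hps2_def
  rw [hflτn2] at hτn2
  rw [← hτn2] at hτn2F hτn2le hsum2
  -- sizes
  have hσ0pos : 0 < σ0 := lt_trans (two_zpow_pos _) hNU
  have hufp0 : 0 < ufp σ0 :=
    lt_of_lt_of_le (two_zpow_pos _) (two_zpow_le_ufp (le_abs.2 (Or.inl hNU.le)))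
  have hσ01pos : 0 < σ01 := lt_trans (two_zpow_pos _) hNU1
  have hA1 : ufp σ01 ≤ σ01 := by
    have := ufp_le_abs σ01; rwa [abs_of_pos hσ01pos] at this
  have hσ02pos : 0 < σ02 := lt_trans (two_zpow_pos _) hNU2
  have hA2 : ufp σ02 ≤ σ02 := by
    have := ufp_le_abs σ02; rwa [abs_of_pos hσ02pos] at this
  -- `|Δ| = |Σ pᵢ^(m+2)| ≤ n·eps·σ₀^(m+2) ≤ 2n·eps·σ₀^(m+2)`
  have hBΔ : |ps2.sum| ≤ 2 * (n : ℚ) * u * σ02 := by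
    have h1 : (ps2.map abs).sum ≤ (ps2.length : ℚ) * (2 * u * ufp σ02) :=
      sum_map_abs_le_length_mul fun y hy => (hps2 y hy).2
    rw [hlen4] at h1
    have h2 : (n : ℚ) * (2 * u * ufp σ02) ≤ (n : ℚ) * (2 * u * σ02) :=
      mul_le_mul_of_nonneg_left (mul_le_mul_of_nonneg_left hA2 (by positivity)) hnn
    linarith [abs_list_sum_le ps2, h1, h2]
  -- (5.11) at levels `m` and `m+1`
  have h511 : (1 - (3 * (n : ℚ) + 2) * u) * σ01 ≤ 4 * (n : ℚ) * u * ufp σ0 := by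
    rw [hσ01]
    exact sigmaZero_le_of_tBound_le hp2 he1 hfl h42 hT'F hT'0 hT'M2 (by rw [← hσ01]; exact hNU1)
  have h511' : (1 - (3 * (n : ℚ) + 2) * u) * σ02 ≤ 4 * (n : ℚ) * u * σ01 := by
    have h' : (1 - (3 * (n : ℚ) + 2) * u) * σ02 ≤ 4 * (n : ℚ) * u * ufp σ01 := by
      rw [hσ02]
      exact sigmaZero_le_of_tBound_le hp2 he1 hfl h42 hT2F hT20 hT2M2 (by rw [← hσ02]; exact hNU2)
    have : 4 * (n : ℚ) * u * ufp σ01 ≤ 4 * (n : ℚ) * u * σ01 :=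
      mul_le_mul_of_nonneg_left hA1 (by positivity)
    linarith
  have hcϕ0 : 0 < 1 - (3 * (n : ℚ) + 2) * u := by nlinarith [h128q, hn0, hu0]
  -- the numeric conditions of `window_faithful`
  have hpoly := poly52b hu0 hn0 h128q
  have hpolyU := poly52bU hu0 hn0 h128q
  have hnumD : (u * (3 + 8 * u) * (σ01 / 2) + 5 * u * (σ02 / 2) + 2 * (2 * (n : ℚ) * u * σ02)) *
      (1 - 5 * u) <
      u * (1 - 5 * u - 7 * u ^ 2) * (1 - u) * (2 * (n : ℚ) * ((n : ℚ) + 2) * u * ufp σ0) := by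
    have t1 : (5 * u / 2 + 4 * (n : ℚ) * u) * (1 - 5 * u) * ((1 - (3 * (n : ℚ) + 2) * u) * σ02) ≤
        (5 * u / 2 + 4 * (n : ℚ) * u) * (1 - 5 * u) * (4 * (n : ℚ) * u * σ01) :=
      mul_le_mul_of_nonneg_left h511' (by positivity)
    have t1' := mul_le_mul_of_nonneg_left t1 hcϕ0.le
    have t2 : ((1 - (3 * (n : ℚ) + 2) * u) * (u * (3 + 8 * u) * (1 - 5 * u) / 2) +
        4 * (n : ℚ) * u * ((5 * u / 2 + 4 * (n : ℚ) * u) * (1 - 5 * u))) *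
        ((1 - (3 * (n : ℚ) + 2) * u) * σ01) ≤
        ((1 - (3 * (n : ℚ) + 2) * u) * (u * (3 + 8 * u) * (1 - 5 * u) / 2) +
        4 * (n : ℚ) * u * ((5 * u / 2 + 4 * (n : ℚ) * u) * (1 - 5 * u))) *
        (4 * (n : ℚ) * u * ufp σ0) :=
      mul_le_mul_of_nonneg_left h511 (by positivity)
    have t3 : 2 * (n : ℚ) * u ^ 2 * ufp σ0 *
        (((3 + 8 * u) * (1 - (3 * n + 2) * u) + (20 + 32 * n) * n * u) * (1 - 5 * u)) <
        2 * (n : ℚ) * u ^ 2 * ufp σ0 *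
        ((1 - 5 * u - 7 * u ^ 2) * (1 - u) * (n + 2) * (1 - (3 * n + 2) * u) ^ 2) :=
      mul_lt_mul_of_pos_left hpoly (by positivity)
    have key : (1 - (3 * (n : ℚ) + 2) * u) ^ 2 *
        ((u * (3 + 8 * u) * (σ01 / 2) + 5 * u * (σ02 / 2) + 2 * (2 * (n : ℚ) * u * σ02)) *
          (1 - 5 * u)) <
        (1 - (3 * (n : ℚ) + 2) * u) ^ 2 *
        (u * (1 - 5 * u - 7 * u ^ 2) * (1 - u) * (2 * (n : ℚ) * ((n : ℚ) + 2) * u * ufp σ0)) := by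
      linarith only [t1', t2, t3]
    exact lt_of_mul_lt_mul_left key (sq_nonneg _)
  have hnumU : (4 * (n : ℚ) * u * ufp σ0 + (1 + 4 * u) * (σ01 / 2) + (1 + u) * (σ02 / 2)) *
      (1 - 5 * u) ≤
      (1 - 2 * u - 4 * u ^ 2) * (1 - u) * (2 * (n : ℚ) * ((n : ℚ) + 2) * u * ufp σ0) := by
    have v1 : (1 + u) * (1 - 5 * u) / 2 * ((1 - (3 * (n : ℚ) + 2) * u) * σ02) ≤
        (1 + u) * (1 - 5 * u) / 2 * (4 * (n : ℚ) * u * σ01) :=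
      mul_le_mul_of_nonneg_left h511' (by positivity)
    have v1' := mul_le_mul_of_nonneg_left v1 hcϕ0.le
    have v2 : ((1 - (3 * (n : ℚ) + 2) * u) * ((1 + 4 * u) * (1 - 5 * u) / 2) +
        2 * (n : ℚ) * u * ((1 + u) * (1 - 5 * u))) * ((1 - (3 * (n : ℚ) + 2) * u) * σ01) ≤
        ((1 - (3 * (n : ℚ) + 2) * u) * ((1 + 4 * u) * (1 - 5 * u) / 2) +
        2 * (n : ℚ) * u * ((1 + u) * (1 - 5 * u))) * (4 * (n : ℚ) * u * ufp σ0) :=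
      mul_le_mul_of_nonneg_left h511 (by positivity)
    have v3 : 2 * (n : ℚ) * u * ufp σ0 *
        ((2 * (1 - (3 * n + 2) * u) ^ 2 + (1 + 4 * u) * (1 - (3 * n + 2) * u) + 4 * (1 + u) * n * u) *
          (1 - 5 * u)) ≤
        2 * (n : ℚ) * u * ufp σ0 * ((1 - 2 * u - 4 * u ^ 2) * (1 - u) * (n + 2) * (1 - (3 * n + 2) * u) ^ 2) :=
      mul_le_mul_of_nonneg_left hpolyU (by positivity)
    have key : (1 - (3 * (n : ℚ) + 2) * u) ^ 2 *
        ((4 * (n : ℚ) * u * ufp σ0 + (1 + 4 * u) * (σ01 / 2) + (1 + u) * (σ02 / 2)) * (1 - 5 * u)) ≤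
        (1 - (3 * (n : ℚ) + 2) * u) ^ 2 *
        ((1 - 2 * u - 4 * u ^ 2) * (1 - u) * (2 * (n : ℚ) * ((n : ℚ) + 2) * u * ufp σ0)) := by
      linarith only [v1', v2, v3]
    exact le_of_mul_le_mul_left key (by positivity)
  exact window_faithful hp he hfl hn2 hN hinv hσ0 h49 hΦ hσ01 h49' hτn2F (Δ := ps2.sum) hsum2
    hτn2le hBΔ hnumD hnumU ht1 hτ2 hτn1

/-! ### Proposition 5.2: the induction over the last loop and the main statement -/

/-- Equation lemmas of `firedResult`. [cite: Rump2009, Algorithm 5.1] -/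
theorem firedResult_nil (fl : ℚ → ℚ) (e t1 τ2 : ℚ) : firedResult fl e t1 τ2 [] = fl (t1 + fl (τ2 + e)) := rfl

/-- The fired result for `m = K − 2`. [cite: Rump2009, Algorithm 5.1 (`if m = K − 2`)] -/
theorem firedResult_one (fl : ℚ → ℚ) (e t1 τ2 σt1 σ01 : ℚ) :
    firedResult fl e t1 τ2 [(σt1, σ01)] =
      fl (t1 + fl (fl (τ2 + fl (σt1 - σ01)) +
        fl (fl (fl (τ2 - fl (τ2 + fl (σt1 - σ01))) + fl (σt1 - σ01)) + e))) := rfl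

/-- The fired result for `m < K − 2`. [cite: Rump2009, Algorithm 5.1 (`else % m < K − 2`)] -/
theorem firedResult_two (fl : ℚ → ℚ) (e t1 τ2 σt1 σ01 σt2 σ02 : ℚ) (rest : List (ℚ × ℚ)) :
    firedResult fl e t1 τ2 ((σt1, σ01) :: (σt2, σ02) :: rest) =
      fl (t1 + fl (fl (τ2 + fl (σt1 - σ01)) +
        fl (fl (fl (τ2 - fl (τ2 + fl (σt1 - σ01))) + fl (σt1 - σ01)) + fl (σt2 - σ02)))) := rfl

/-- The vectors of the column-by-column scheme are floating-point vectors (each pass is a sequence of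
roundings). [cite: Rump2009, Algorithm 5.1 and Lemma 4.2] -/
theorem isFloat_of_mem_extractChain_snd (hfl : IsRoundNearest p emin fl) :
    ∀ (lv : List (ℚ × ℚ)) (xs : List ℚ), (∀ x ∈ xs, IsFloat p emin x) →
      ∀ y ∈ (extractChain fl lv xs).2, IsFloat p emin y
  | [], xs, hxs, y, hy => hxs y (by simpa using hy)
  | (σt, σ0) :: rest, xs, _, y, hy => by
      rw [extractChain_cons] at hy
      exact isFloat_of_mem_extractChain_snd hfl rest _
        (isFloat_of_mem_extractVectorNew_snd hfl σt xs) y hy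

/-- Projections of one level of the preamble when the flag is not raised there.
[cite: Rump2009, Algorithm 5.1 (first `for` loop)] -/
theorem precParams_succ_of_lt (fl : ℚ → ℚ) (p : ℕ) (emin : ℤ) (n k : ℕ) (T : ℚ)
    (h : (2 : ℚ) ^ (emin + p) < 4 * tBound fl p n (sigmaZero fl p n T)) :
    (precParams fl p emin n (k + 1) T).1 =
        sigmaZero fl p n T :: (precParams fl p emin n k (tBound fl p n (sigmaZero fl p n T))).1 ∧
      (precParams fl p emin n (k + 1) T).2 =
        (precParams fl p emin n k (tBound fl p n (sigmaZero fl p n T))).2 := by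
  rw [precParams_succ, if_neg (not_le.mpr h)]; exact ⟨rfl, rfl⟩

/-- If the flag of the preamble is not raised, no level raised it: in particular not the first.
[cite: Rump2009, Algorithm 5.1 (first `for` loop)] -/
theorem lt_four_tBound_of_flag_false (fl : ℚ → ℚ) (p : ℕ) (emin : ℤ) (n k : ℕ) (T : ℚ)
    (h : (precParams fl p emin n (k + 1) T).2 = false) :
    (2 : ℚ) ^ (emin + p) < 4 * tBound fl p n (sigmaZero fl p n T) := by
  by_contra hc
  rw [precParams_succ, if_pos (not_lt.mp hc)] at h
  exact Bool.noConfusion h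

/-- **Proposition 5.2, the faithful part, along the last loop** (induction over the remaining levels
from a loop state `(t, T, p)` satisfying the invariant of Lemma 4.9): if no level raised the
`ExactFlag` and the stopping criterion is met at some remaining level, the result is a faithful
rounding of `t + Σ pᵢ` — by Lemma 4.10 (`m = K−1`, "the results of FastAccSum and FastPrecSum are
the same"), `fired_caseA_faithful` (`m = K−2`) or `fired_caseB_faithful` (`m < K−2`, where this
formalisation assumes `128n ≤ eps⁻¹`), after Lemma 4.9's `loop_continue` for the levels before `m`.
[cite: Rump2009, Proposition 5.2 (proof: "Denote by m the first index for which |t^(m)| ≥ Φ^(m)")] -/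
theorem finalLoop_faithful (hp : 7 ≤ p) (he : emin + 2 * p ≤ 0) (hfl : IsRoundNearest p emin fl)
    {n : ℕ} (hn2 : 2 ≤ n) (hN : 2 * n ^ 2 + 4 * n + 6 ≤ 2 ^ p) :
    ∀ (k : ℕ) {t T : ℚ} {xs : List ℚ}, LoopInv p emin fl n t T xs →
      (precParams fl p emin n k T).2 = false →
      criterionMet fl p n t
        (extractChain fl (((precParams fl p emin n k T).1).map fun s => (s, s)) xs).1 = true →
      (k ≤ 2 ∨ 128 * n ≤ 2 ^ p) →
      IsFaithfulRounding p emin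
        (finalLoop fl p n
          (flSum fl (extractChain fl (((precParams fl p emin n k T).1).map fun s => (s, s)) xs).2)
          t (extractChain fl (((precParams fl p emin n k T).1).map fun s => (s, s)) xs).1)
        (t + xs.sum)
  | 0, t, T, xs, _, _, hmet, _ => by simp at hmet
  | k + 1, t, T, xs, hinv, hflag, hmet, hK => by
      have hp1 : 1 ≤ p := by omega
      have h49 := lt_four_tBound_of_flag_false fl p emin n k T hflag
      obtain ⟨hpre1, hpre2⟩ := precParams_succ_of_lt fl p emin n k T h49
      rw [hpre2] at hflag
      rw [hpre1] at hmet ⊢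
      set σ0 := sigmaZero fl p n T with hσ0
      set T1 := tBound fl p n σ0 with hT1
      set ps := (extractVectorNew fl σ0 xs).2 with hps
      simp only [List.map_cons, extractChain_cons] at hmet ⊢
      rw [criterionMet_cons] at hmet
      rw [finalLoop_cons]
      by_cases hΦ : phiBound fl p n σ0 ≤ |fl (t + fl ((extractVectorNew fl σ0 xs).1 - σ0))|
      · -- the criterion fires at this level (`m`)
        rw [if_pos hΦ]
        obtain ⟨-, -, -, -, -, hflτ, hτF, -, -, -, hdisj, -⟩ := loop_facts hp he hfl hn2 hN hinv hσ0
        cases k with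
        | zero =>
            -- `m = K − 1`: Lemma 4.10
            have hmain := loop_exit_main hp he hfl hn2 hN hinv hσ0 h49 hΦ
            simp only [precParams_zero, List.map_nil, extractChain_nil, firedResult_nil]
            rw [hflτ] at hmain ⊢
            rw [printed_correction_eq hp1 hfl hinv.tF hτF hdisj]
            exact hmain
        | succ j =>
            have h49' := lt_four_tBound_of_flag_false fl p emin n j T1 hflag
            obtain ⟨hpre1', hpre2'⟩ := precParams_succ_of_lt fl p emin n j T1 h49'
            rw [hpre1']
            simp only [List.map_cons, extractChain_cons]
            cases j with
            | zero =>
                -- `m = K − 2`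
                simp only [precParams_zero, List.map_nil, extractChain_nil, firedResult_one]
                exact fired_caseA_faithful hp he hfl hn2 hN hinv hσ0 h49 hΦ rfl h49' rfl rfl rfl
            | succ i =>
                -- `m < K − 2`
                have h128 : 128 * n ≤ 2 ^ p := hK.resolve_left (by omega)
                rw [hpre2'] at hflag
                have h49'' := lt_four_tBound_of_flag_false fl p emin n i _ hflag
                obtain ⟨hpre1'', -⟩ := precParams_succ_of_lt fl p emin n i _ h49''
                rw [hpre1'']
                simp only [List.map_cons, extractChain_cons, firedResult_two]
                exact fired_caseB_faithful hp he hfl hn2 hN h128 hinv hσ0 h49 hΦ rfl h49' rfl h49''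
                  rfl rfl rfl rfl
      · -- continue with `t = t^(m)`
        rw [if_neg hΦ] at hmet ⊢
        obtain ⟨hinv', hsum', -, -⟩ := loop_continue hp he hfl hn2 hN hinv hσ0 h49 (lt_of_not_ge hΦ)
        rw [← hsum']
        exact finalLoop_faithful hp he hfl hn2 hN k hinv' hflag hmet (hK.imp_left (by omega))

/-- **Proposition 5.2 (faithful part)**: let `pᵢ ∈ F`, `n ≥ 2`, `(2n²+4n+6)eps ≤ 1`, `eps ≤ 1/128`
(binary64-like formats: `p ≥ 7`, `emin + 2p ≤ 0`), and — in this formalisation — `K ≤ 3` or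
`128n ≤ eps⁻¹`. If the `ExactFlag` is not set and the condition `|t^(m)| ≥ Φ^(m)` is satisfied
for some `1 ≤ m ≤ K − 1`, then `res = FastPrecSum(p, K)` is a faithful rounding of `s = Σ pᵢ`.
(The `ExactFlag` branch is NOT faithful in general: `fastPrecSum_exactFlag_counterexample`; the
error estimate (5.3) of the exceptional case is not formalised here.)
[cite: Rump2009, Proposition 5.2] -/
theorem isFaithfulRounding_fastPrecSum (hp : 7 ≤ p) (he : emin + 2 * p ≤ 0)
    (hfl : IsRoundNearest p emin fl) {xs : List ℚ} (hxs : ∀ x ∈ xs, IsFloat p emin x)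
    (hn2 : 2 ≤ xs.length) (hN : 2 * xs.length ^ 2 + 4 * xs.length + 6 ≤ 2 ^ p) {K : ℕ}
    (hK : K ≤ 3 ∨ 128 * xs.length ≤ 2 ^ p) (hflag : exactFlag fl p emin K xs = false)
    (hmet : criterionMetRun fl p emin K xs = true) :
    IsFaithfulRounding p emin (fastPrecSum fl p emin K xs) xs.sum := by
  have hp1 : 1 ≤ p := by omega
  have he1 : emin + p ≤ 0 := by omega
  obtain ⟨-, -, -, -, -, hnle⟩ := format_facts hp hn2 hN
  have hlt : xs.length < 2 ^ p := by
    have : xs.length < 2 * xs.length ^ 2 + 4 * xs.length + 6 := by nlinarith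
    omega
  have hT : (xs.map abs).sum ≤ tInit fl p xs := sum_abs_le_tInit hp1 he1 hfl hxs hlt
  have hinv : LoopInv p emin fl xs.length 0 (tInit fl p xs) xs :=
    ⟨hxs, rfl, (hfl _).1, hT, isFloat_zero p emin, onGrid_zero _, by
      rw [abs_zero, mul_zero]
      have : 0 ≤ tInit fl p xs := (sum_map_abs_nonneg xs).trans hT
      have hu0 : 0 < unitRoundoff p := u_pos
      positivity⟩
  have hflag' : (precParams fl p emin xs.length (K - 1) (tInit fl p xs)).2 = false := hflag
  have hmet' : criterionMet fl p xs.length 0 (rowExtract fl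
      (((precParams fl p emin xs.length (K - 1) (tInit fl p xs)).1).map fun s => (s, s)) 0 xs).1 =
      true := hmet
  have hcond : ¬ ((precParams fl p emin xs.length (K - 1) (tInit fl p xs)).2 = true) := by
    rw [hflag']; exact Bool.false_ne_true
  rw [fastPrecSum, if_neg hcond]
  simp only [rowExtract_eq_extractChain] at hmet' ⊢
  rw [flAcc_zero_eq_flSum hfl (isFloat_of_mem_extractChain_snd hfl _ xs hxs)]
  have := finalLoop_faithful hp he hfl hn2 hN (K - 1) hinv hflag' hmet' (hK.imp_left (by omega))
  rwa [zero_add] at this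

/-! ### The `ExactFlag` branch as printed is not faithful -/

set_option maxHeartbeats 400000 in
/-- The `ExactFlag` branch of Algorithm 5.1 AS PRINTED (`res = e = fl(Σ p̃ᵢ)`) does not return a
faithful rounding in general — the sentence "If the ExactFlag is set, then by Lemma 4.10 the
floating-point sum of the extracted vector is equal to the true sum" (p. 3493) overlooks that
Lemma 4.10 is about `t^(m−1) + τ^(m) + Σ pᵢ^(m)` while `e` omits the exact parts
`τ^(ν) = σ̃^(ν) − σ₀^(ν)` (FastAccSum's `res = fl(τ₁ + fl(τ₂ + fl(Σ pᵢ^(m))))`, (4.30)). Witness for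
ANY rounding to nearest, `p ≥ 7`, `emin + 2p ≤ 0`, any `K ≥ 2`: the vector `(X, X)` with
`X = eps⁻¹eta = 2^(emin+p)`: the flag is raised at level `m = 1` (`ufp(σ₀^(1)) = 4X`,
`4T^(1) ≤ 4·fl(4eps·4X) = 64eta ≤ eps⁻¹eta`), both summands are absorbed into `σ̃^(1)`
(`p̃ᵢ = 0`), so `res = e = 0`, whereas `s = 2X` and `X ∈ F` lies strictly between `res` and `s`.
[cite: Rump2009, Algorithm 5.1 (`if ExactFlag then res = e`) — refuted as printed; cf. Lemma 4.10] -/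
theorem fastPrecSum_exactFlag_counterexample (hp : 7 ≤ p) (he : emin + 2 * p ≤ 0)
    (hfl : IsRoundNearest p emin fl) {K : ℕ} (hK : 2 ≤ K) :
    exactFlag fl p emin K [(2 : ℚ) ^ (emin + p), (2 : ℚ) ^ (emin + p)] = true ∧
      fastPrecSum fl p emin K [(2 : ℚ) ^ (emin + p), (2 : ℚ) ^ (emin + p)] = 0 ∧
      ¬ IsFaithfulRounding p emin 0 ((2 : ℚ) ^ (emin + p) + (2 : ℚ) ^ (emin + p)) := by
  have hp1 : 1 ≤ p := by omega
  have hp2 : 2 ≤ p := by omega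
  have he1 : emin + p ≤ 0 := by omega
  have h2p : (128 : ℕ) ≤ 2 ^ p :=
    le_trans (by norm_num) (Nat.pow_le_pow_right (by norm_num) hp)
  have h2pZ : (128 : ℤ) ≤ 2 ^ p := by exact_mod_cast h2p
  set u := unitRoundoff p with hu
  set X := (2 : ℚ) ^ (emin + p) with hX
  have hu0 : 0 < u := u_pos
  have hu128 : u ≤ 1 / 128 := by
    obtain ⟨h, -⟩ := format_facts hp (n := 2) le_rfl (le_trans (by norm_num) h2p)
    exact h
  have hX0 : 0 < X := two_zpow_pos _
  have huX : u * X ≤ 1 / 128 * X := mul_le_mul_of_nonneg_right hu128 hX0.le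
  have hXF : IsFloat p emin X := isFloat_two_zpow hp1 (by omega)
  have h2XF : IsFloat p emin (2 * X) := isFloat_two_mul hXF
  -- some explicit floating-point numbers
  have h4X : (4 : ℚ) * X = (2 : ℚ) ^ (emin + p + 2) := by
    rw [hX, zpow_add₀ (by norm_num : (2 : ℚ) ≠ 0) (emin + p) 2]; norm_num; ring
  have h8X : (8 : ℚ) * X = (2 : ℚ) ^ (emin + p + 2 + 1) := by
    rw [hX, show emin + (p : ℤ) + 2 + 1 = emin + p + 3 by ring,
      zpow_add₀ (by norm_num : (2 : ℚ) ≠ 0) (emin + p) 3]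
    norm_num; ring
  have h4XF : IsFloat p emin (4 * X) := by rw [h4X]; exact isFloat_two_zpow hp1 (by omega)
  have h33F : IsFloat p emin (33 / 16 * X) := by
    have h := isFloat_of_abs_le (p := p) (emin := emin) hp1 (N := 33) (k := emin + p - 4)
      (by rw [abs_of_nonneg (by norm_num)]; linarith) (by omega)
    have e : ((33 : ℤ) : ℚ) * (2 : ℚ) ^ (emin + p - 4) = 33 / 16 * X := by
      rw [hX, zpow_sub₀ (by norm_num : (2 : ℚ) ≠ 0) (emin + p) 4]; norm_num; ring
    rwa [e] at h
  have h92F : IsFloat p emin (9 / 2 * X) := by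
    have h := isFloat_of_abs_le (p := p) (emin := emin) hp1 (N := 9) (k := emin + p - 1)
      (by rw [abs_of_nonneg (by norm_num)]; linarith) (by omega)
    have e : ((9 : ℤ) : ℚ) * (2 : ℚ) ^ (emin + p - 1) = 9 / 2 * X := by
      rw [hX, zpow_sub₀ (by norm_num : (2 : ℚ) ≠ 0) (emin + p) 1]; norm_num; ring
    rwa [e] at h
  have hKu : ∀ K : ℕ, K ≤ 2 ^ p → fl ((K : ℚ) * u) = (K : ℚ) * u := fun K hK =>
    fl_eq_self hfl (isFloat_natCast_mul_u hp1 hK he1)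
  have h1Ku : ∀ K : ℕ, K ≤ 2 ^ p → fl (1 - (K : ℚ) * u) = 1 - (K : ℚ) * u := fun K hK =>
    fl_eq_self hfl (isFloat_one_sub_natCast_mul_u hp1 hK he1)
  have h2u : fl (2 * u) = 2 * u := by have := hKu 2 (by omega); push_cast at this; exact this
  have h12u : fl (1 - 2 * u) = 1 - 2 * u := by have := h1Ku 2 (by omega); push_cast at this; exact this
  have h7u : fl (7 * u) = 7 * u := by have := hKu 7 (by omega); push_cast at this; exact this
  have h17u : fl (1 - 7 * u) = 1 - 7 * u := by have := h1Ku 7 (by omega); push_cast at this; exact this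
  have h4u : fl (4 * u) = 4 * u := by have := hKu 4 (by omega); push_cast at this; exact this
  -- `T^(0) = fl(2X/(1 − 2eps)) ∈ [2X, (33/16)X]`
  set T0 := tInit fl p [X, X] with hT0def
  have hT0 : T0 = fl (2 * X / (1 - 2 * u)) := by
    rw [hT0def, tInit]
    simp only [List.map_cons, List.map_nil, abs_of_pos hX0, List.length_cons, List.length_nil,
      flSum_pair]
    push_cast
    rw [← two_mul, fl_eq_self hfl h2XF, ← hu, h2u, h12u]
  have h12pos : 0 < 1 - 2 * u := by linarith
  have hT0F : IsFloat p emin T0 := by rw [hT0]; exact (hfl _).1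
  have hT0lo : 2 * X ≤ T0 := by
    rw [hT0]; refine le_fl_of_le hfl h2XF ?_
    rw [le_div_iff₀ h12pos]; nlinarith [mul_pos hu0 hX0]
  have hT0hi : T0 ≤ 33 / 16 * X := by
    rw [hT0]; refine fl_le_of_le hfl h33F ?_
    rw [div_le_iff₀ h12pos]; nlinarith [huX, hX0]
  -- `σ₀ = σ₀^(1) = fl(2T^(0)/(1 − 7eps)) ∈ [4X, (9/2)X]`, `ufp(σ₀) = 4X`
  set σ0 := sigmaZero fl p 2 T0 with hσ0def
  have hσ0 : σ0 = fl (2 * T0 / (1 - 7 * u)) := by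
    rw [hσ0def, sigmaZero]; push_cast
    rw [fl_eq_self hfl (isFloat_two_mul hT0F), ← hu, show (3 * 2 + 1 : ℚ) * u = 7 * u by norm_num,
      h7u, h17u]
  have h17pos : 0 < 1 - 7 * u := by linarith
  have hσ0F : IsFloat p emin σ0 := by rw [hσ0]; exact (hfl _).1
  have hσ0lo : 4 * X ≤ σ0 := by
    rw [hσ0]; refine le_fl_of_le hfl h4XF ?_
    rw [le_div_iff₀ h17pos]; nlinarith [mul_pos hu0 hX0, hT0lo]
  have hσ0hi : σ0 ≤ 9 / 2 * X := by
    rw [hσ0]; refine fl_le_of_le hfl h92F ?_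
    rw [div_le_iff₀ h17pos]; nlinarith [huX, hT0hi, hX0]
  have hσ0pos : 0 < σ0 := by linarith
  have hufp : ufp σ0 = 4 * X := by
    apply le_antisymm
    · rw [h4X]; apply ufp_le_two_zpow_of_abs_lt
      rw [abs_of_pos hσ0pos, ← h8X]; linarith
    · rw [h4X]; apply two_zpow_le_ufp
      rw [abs_of_pos hσ0pos, ← h4X]; exact hσ0lo
  -- the flag is raised at level 1: `4T^(1) ≤ 4·fl(4eps·ufp(σ₀)) = 64eta ≤ eps⁻¹eta`
  have hflag1 : 4 * tBound fl p 2 σ0 ≤ (2 : ℚ) ^ (emin + p) := by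
    have hB : tBound fl p 2 σ0 ≤ fl (fl (2 * (2 : ℕ) * u) * ufpFl fl p σ0) := min_le_right _ _
    rw [ufpFl_eq_ufp hp2 hfl hσ0F, hufp] at hB
    push_cast at hB
    rw [show (2 * 2 : ℚ) * u = 4 * u by norm_num, h4u] at hB
    have e : 4 * u * (4 * X) = (2 : ℚ) ^ (emin + 4) := by
      rw [show 4 * u * (4 * X) = 16 * (u * X) by ring, hu, hX, u_mul_two_zpow,
        show emin + (p : ℤ) - p = emin by ring, zpow_add₀ (by norm_num : (2 : ℚ) ≠ 0) emin 4]
      norm_num; ring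
    rw [e, fl_eq_self hfl (isFloat_two_zpow hp1 (by omega))] at hB
    have h6 : (2 : ℚ) ^ (emin + 4) * 2 ^ (2 : ℤ) ≤ (2 : ℚ) ^ (emin + p) := by
      rw [← zpow_add₀ (by norm_num : (2 : ℚ) ≠ 0)]
      exact zpow_le_zpow_right₀ (by norm_num) (by omega)
    have : (2 : ℚ) ^ (2 : ℤ) = 4 := by norm_num
    rw [this] at h6
    linarith
  -- hence `precParams` returns `([σ₀], true)`
  obtain ⟨j, hj⟩ : ∃ j, K - 1 = j + 1 := ⟨K - 2, by omega⟩
  have hlen : ([X, X] : List ℚ).length = 2 := rfl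
  have hpre : precParams fl p emin 2 (K - 1) T0 = ([σ0], true) := by
    rw [hj, precParams_succ, if_pos hflag1]
  -- the extraction absorbs both summands: `σ₀ + X, σ₀ + 2X ∈ F`
  have hgridσ : OnGrid ((2 : ℚ) ^ (emin + 3)) σ0 := by
    have := onGrid_of_isFloat_of_le_abs hσ0F (E := emin + p + 2)
      (by rw [abs_of_pos hσ0pos, ← h4X]; exact hσ0lo)
    rwa [show emin + (p : ℤ) + 2 - p + 1 = emin + 3 by ring] at this
  have hgridX : OnGrid ((2 : ℚ) ^ (emin + 3)) X := (onGrid_self _).of_le (by omega)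
  have h8X' : (2 : ℚ) ^ p * (2 : ℚ) ^ (emin + 3) = 8 * X := by
    rw [h8X, ← zpow_natCast, ← zpow_add₀ (by norm_num : (2 : ℚ) ≠ 0)]; congr 1; ring
  have hσXF : IsFloat p emin (σ0 + X) :=
    isFloat_of_onGrid_two_zpow hp1 (hgridσ.add hgridX)
      (by rw [h8X', abs_of_pos (by linarith)]; linarith) (by omega)
  have hσ2XF : IsFloat p emin (σ0 + X + X) :=
    isFloat_of_onGrid_two_zpow hp1 ((hgridσ.add hgridX).add hgridX)
      (by rw [h8X', abs_of_pos (by linarith)]; linarith) (by omega)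
  have hrow : (rowExtract fl [(σ0, σ0)] 0 [X, X]).2 = 0 := by
    simp only [rowExtract_cons, rowExtract_nil, rowPass_cons, rowPass_nil, fast2Sum,
      fl_eq_self hfl hσXF, fl_eq_self hfl hσ2XF, add_sub_cancel_left, add_sub_cancel_left,
      fl_eq_self hfl hXF, sub_self, fl_zero hfl, add_zero]
  refine ⟨?_, ?_, ?_⟩
  · rw [exactFlag, hlen, hpre]
  · rw [fastPrecSum, hlen, hpre]
    simp only [if_true, List.map_cons, List.map_nil]
    exact hrow
  · intro h
    have := h.2.2 X hXF hX0
    linarith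

end Literature.ComputerArithmetic.Rump2009
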